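import Summits.AnomalousDissipation.AnomalousDissipation.Theorems.SolenoidalFractalHomogenisationLagrangianStepCellLawVOddGainDefectLowerEdge
import Literature.Analysis.Fourier.FractalUncertaintyFourierTools

/-!
# K1L `LagrangianRenormalisationStep(Design)` (K1L_D, stmt-AnomalousDissipation-27980; aside 24912), stub `stub_cellLawV0_IS`
# — W5 odd half, branch B of D24-16: EXACT SECTOR NON-EXPANSION of the quasi-static slot response `f_T(B)` (`θ = 1`), PROVED

Planner ad-ideate-p5 g8 (lens «profile»), crux workfile `Cruxes/LagrangianRenormalisationStep/OddGainDefectAutocorr.lean` v2, on top of the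
worker's `…CellLawVOddGainDefectLowerEdge` (p654671: `qsKernel` tools, `form_qsResp_eq`) and the tree's Fourier toolkit
`Literature.Analysis.Fourier.FractalUncertaintyFourierTools`.  THIS IS THE «MISSING ANALYTIC BRICK» named by the worker (STATUS 18:42:30Z, p658069
`resolvent_form_sector`): the representation of `f_T(B)` as a NONNEGATIVE mixture of resolvent atoms, and with it the exact (`θ = 1`) sector
non-expansion that the worker's design line needs for `ΛV = 1.05` («ΛV = 1.05 needs exact non-expansion»).  Everything PROVED, no sorry, no named fact:
* §11 `qsKernel_eq_autocorr`, `form_qsResp_eq_autocorr(_Ioi)` — `xᵀf_T(B)z = T∫₀^∞ A(u)·xᵀe^{−uTB}z du`, `A(u) = ∫₀¹a(s)a(s−u)ds` (ramp autocorrelation);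
  `integral_Ioi_cos_mul_form_exp` — the Laplace–cosine transform `∫₀^∞cos(ξu)·xᵀe^{−uC}z du = xᵀC(C² + ξ²)⁻¹z` for coercive `C` (FTC on `Ioi`);
* §12 `fourier_boxC(_mul_neg)`, `trapC_eq_smul_conv` (`a = ρ⁻¹𝟙_{[0,ρ]} ⋆ 𝟙_{[0,1−ρ]}`), `rampAutocorr_eq_conv` (`A = a ⋆ a(−·)`),
  **`fourier_rampAutocorrC`** — `𝓕A(ξ) = sin²(πρξ)sin²(π(1−ρ)ξ)/(ρ²π⁴ξ⁴) =: trapSpec ρ ξ ≥ 0` (`ξ ≠ 0`, `0 < ρ ≤ 1/2`; Wiener–Khinchin by `Real.fourier_mul_convolution_eq`);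
* §13 `integrable_trapSpec` (majorant `2(1+ξ²)⁻¹`), **`rampAutocorr_eq_integral_trapSpec`** (Mathlib `Continuous.fourierInv_fourier_eq`),
  **`rampAutocorr_eq_slotSpec_integral`** — `A(u) = (1/π)∫₀^∞ Â_ρ(η)cos(ηu)dη`, `Â_ρ(η) = slotSpec ρ η = 16sin²(ρη/2)sin²((1−ρ)η/2)/(ρ²η⁴)`;
* §14 **`cosineMixture_holds : 0 < ρ ≤ 1/2 → CosineMixture ρ`** — `xᵀf_T(B)z = (T/π)∫₀^∞ Â_ρ(η)·xᵀ(TB)((TB)² + η²)⁻¹z dη` with integrability, for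
  `T > 0` and every coercive `B` (Fubini on `(0,∞)²`, majorant `Â_ρ(η)e^{−Tλ₀u}|x||z|`);
* §15 `sector_resolventAtom` (the atom `C(C² + s)⁻¹` of a coercive `τ`-sectorial `C` is `τ`-sectorial and accretive, `s ≥ 0`),
  `sectorPreservation_of_cosineMixture` (discriminant trick), **`sectorPreservation_qsResp`** — for `0 < ρ ≤ 1/2`, `T > 0`, coercive `τ`-sectorial `B`:
  `(xᵀFz − zᵀFx)² ≤ τ²(xᵀFx)(zᵀFz)`, `F = qsResp ρ T B` — **L1⁺ with NO loss (`θ = 1`)**; `form_qsResp_nonneg`.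
* §16 (v3 36f85308f73f: `oddSectorial_excQS_of_design_exact` / `oddSectorial_excQS_contraction_exact`, κ = (ϑ_∞/(lo·m₂))·√5/3) is WITHDRAWN in v4 —
  SUPERSEDED by the worker's p659721 `…CellLawVExactDesign` (same statement and name, landed 19:05Z on top of its time-domain proof p659391
  `sector_form_qsResp_exact`); §11 landed as `Theorems/…CellLawVOddGainDefectAutocorr` (k3l g5, 19:03Z).  §12–§15 below are an INDEPENDENT (Fourier-side)
  proof of p659391's theorem plus the spectral representation `CosineMixture`, which p659391 does not give.
LANDING KIT (planners cannot propose Theorems): files ≤ 400 lines in custody `HOME/ad-ideate-p5/k1l-odd-defect/split/` (+ SHA256SUMS), each checked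
rc 0 with its not-yet-landed siblings inlined: 1 `…CellLawVOddGainDefectAutocorr` (§11) → 2 `…Spectral` (§12–§13) ∥ 3 `…SectorAtoms` (`resolventAtom` + §15
algebra) → 4 `…CosineMixture` (§14 + `sectorPreservation_*`, `form_qsResp_nonneg`) (file 5 `…ExactDesign` withdrawn, see §16 note); each
`--kind proof --supports stmt-AnomalousDissipation-27980 --as helper`; decl names clash-free against all `Theorems/…CellLawVOddGain*.lean` (19:0xZ).
NOT a proof of the stub, of the crux, of Onsager's conjecture or of anomalous dissipation — rung-leaf F-D1.A0 analysis.
-/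

set_option linter.dupNamespace false

namespace Summit.AnomalousDissipation.AnomalousDissipation.Theorems.SolenoidalFractalHomogenisation.LagrangianStep.OddGain

open MeasureTheory Set Matrix Literature.Analysis Literature.Analysis.FluidPDE Literature.Analysis.FluidPDE.LatticeShear
open Literature.Analysis.ODE.PeriodicAveraging

/-- The AUTOCORRELATION of the unit ramp profile at lag `u`: `A(u) = ∫₀¹ a(s) a(s − u) ds`. [folklore] -/
noncomputable def rampAutocorr (ρ u : ℝ) : ℝ :=
  ∫ s in (0:ℝ)..1, LatticeShear.LatticeWord.trapezoid 0 1 ρ s * LatticeShear.LatticeWord.trapezoid 0 1 ρ (s - u)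

/-- The unit ramp profile vanishes at non-positive arguments (`ρ > 0`). [folklore] -/
theorem trapezoid_unit_eq_zero_of_nonpos {ρ : ℝ} (hρ : 0 < ρ) {y : ℝ} (hy : y ≤ 0) :
    LatticeShear.LatticeWord.trapezoid 0 1 ρ y = 0 := by
  unfold LatticeShear.LatticeWord.trapezoid
  have h1 : (y - 0) / (ρ * 1) ≤ 0 := by
    rw [sub_zero, mul_one]; exact div_nonpos_of_nonpos_of_nonneg hy hρ.le
  have h2 : min 1 (min ((y - 0) / (ρ * 1)) ((0 + 1 - y) / (ρ * 1))) ≤ 0 :=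
    (min_le_right _ _).trans ((min_le_left _ _).trans h1)
  exact max_eq_left h2

/-- The unit ramp profile vanishes at arguments `≥ 1` (`ρ > 0`). [folklore] -/
theorem trapezoid_unit_eq_zero_of_one_le {ρ : ℝ} (hρ : 0 < ρ) {y : ℝ} (hy : 1 ≤ y) :
    LatticeShear.LatticeWord.trapezoid 0 1 ρ y = 0 := by
  unfold LatticeShear.LatticeWord.trapezoid
  have h1 : (0 + 1 - y) / (ρ * 1) ≤ 0 := by
    rw [zero_add, mul_one]; exact div_nonpos_of_nonpos_of_nonneg (by linarith) hρ.le
  have h2 : min 1 (min ((y - 0) / (ρ * 1)) ((0 + 1 - y) / (ρ * 1))) ≤ 0 :=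
    (min_le_right _ _).trans ((min_le_right _ _).trans h1)
  exact max_eq_left h2

/-- The autocorrelation vanishes at lags `u ≥ 1`. [folklore] -/
theorem rampAutocorr_eq_zero_of_one_le {ρ : ℝ} (hρ : 0 < ρ) {u : ℝ} (hu : 1 ≤ u) : rampAutocorr ρ u = 0 := by
  unfold rampAutocorr
  have h : ∫ s in (0:ℝ)..1, LatticeShear.LatticeWord.trapezoid 0 1 ρ s * LatticeShear.LatticeWord.trapezoid 0 1 ρ (s - u) =
      ∫ s in (0:ℝ)..1, (0:ℝ) := by
    refine intervalIntegral.integral_congr fun s hs => ?_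
    rw [uIcc_of_le zero_le_one] at hs
    show LatticeShear.LatticeWord.trapezoid 0 1 ρ s * LatticeShear.LatticeWord.trapezoid 0 1 ρ (s - u) = 0
    rw [trapezoid_unit_eq_zero_of_nonpos hρ (y := s - u) (by linarith [hs.2]), mul_zero]
  rw [h, intervalIntegral.integral_zero]

/-- Inner substitution `x = s − u`: `∫₀ˢ a(x) k(T(s−x)) dx = ∫₀ˢ a(s−u) k(Tu) du`. [folklore] -/
theorem qsKernel_inner_comp_sub (ρ T : ℝ) (k : ℝ → ℝ) (s : ℝ) :
    ∫ x in (0:ℝ)..s, LatticeShear.LatticeWord.trapezoid 0 1 ρ x * k (T * (s - x)) =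
      ∫ u in (0:ℝ)..s, LatticeShear.LatticeWord.trapezoid 0 1 ρ (s - u) * k (T * u) := by
  have h := intervalIntegral.integral_comp_sub_left
    (fun u => LatticeShear.LatticeWord.trapezoid 0 1 ρ (s - u) * k (T * u)) (a := (0:ℝ)) (b := s) s
  simp only [sub_sub_cancel, sub_self, sub_zero] at h
  exact h

/-- Extension of the inner integral to `[0, 1]` (the profile kills `u ≥ s`): for `0 ≤ s ≤ 1`,
`∫₀ˢ a(s−u) k(Tu) du = ∫₀¹ a(s−u) k(Tu) du`. [folklore] -/
theorem qsKernel_inner_extend {ρ : ℝ} (hρ : 0 < ρ) (T : ℝ) {k : ℝ → ℝ} (hk : Continuous k) {s : ℝ}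
    (hs : s ∈ Icc (0:ℝ) 1) :
    ∫ u in (0:ℝ)..s, LatticeShear.LatticeWord.trapezoid 0 1 ρ (s - u) * k (T * u) =
      ∫ u in (0:ℝ)..1, LatticeShear.LatticeWord.trapezoid 0 1 ρ (s - u) * k (T * u) := by
  have hcont : Continuous fun u => LatticeShear.LatticeWord.trapezoid 0 1 ρ (s - u) * k (T * u) :=
    ((continuous_trapezoid_unit ρ).comp (continuous_const.sub continuous_id)).mul
      (hk.comp (continuous_const.mul continuous_id))
  have hzero : ∫ u in s..1, LatticeShear.LatticeWord.trapezoid 0 1 ρ (s - u) * k (T * u) = 0 := by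
    have h : ∫ u in s..1, LatticeShear.LatticeWord.trapezoid 0 1 ρ (s - u) * k (T * u) = ∫ u in s..1, (0:ℝ) := by
      refine intervalIntegral.integral_congr fun u hu => ?_
      rw [uIcc_of_le hs.2] at hu
      show LatticeShear.LatticeWord.trapezoid 0 1 ρ (s - u) * k (T * u) = 0
      rw [trapezoid_unit_eq_zero_of_nonpos hρ (by linarith [hu.1]), zero_mul]
    rw [h, intervalIntegral.integral_zero]
  rw [← intervalIntegral.integral_add_adjacent_intervals (hcont.intervalIntegrable 0 s) (hcont.intervalIntegrable s 1),
    hzero, add_zero]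

/-- **The slot functional through the autocorrelation** (`ρ > 0`, continuous `k`):
`T ∫₀¹ a(s) ∫₀ˢ a(x) k(T(s−x)) dx ds = T ∫₀¹ A(u) k(Tu) du`. [folklore] -/
theorem qsKernel_eq_autocorr {ρ : ℝ} (hρ : 0 < ρ) (T : ℝ) {k : ℝ → ℝ} (hk : Continuous k) :
    T * ∫ s in (0:ℝ)..1, LatticeShear.LatticeWord.trapezoid 0 1 ρ s *
        ∫ x in (0:ℝ)..s, LatticeShear.LatticeWord.trapezoid 0 1 ρ x * k (T * (s - x)) =
    T * ∫ u in (0:ℝ)..1, rampAutocorr ρ u * k (T * u) := by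
  congr 1
  -- the integrand on the square
  set F : ℝ → ℝ → ℝ := fun s u =>
    LatticeShear.LatticeWord.trapezoid 0 1 ρ s * (LatticeShear.LatticeWord.trapezoid 0 1 ρ (s - u) * k (T * u)) with hF
  have hFc : Continuous (Function.uncurry F) := by
    refine ((continuous_trapezoid_unit ρ).comp continuous_fst).mul
      (((continuous_trapezoid_unit ρ).comp (continuous_fst.sub continuous_snd)).mul (hk.comp ?_))
    exact continuous_const.mul continuous_snd
  -- Step 1: rewrite the inner integral (substitution + extension), pull `a(s)` inside
  have h1 : ∫ s in (0:ℝ)..1, LatticeShear.LatticeWord.trapezoid 0 1 ρ s *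
        ∫ x in (0:ℝ)..s, LatticeShear.LatticeWord.trapezoid 0 1 ρ x * k (T * (s - x)) =
      ∫ s in (0:ℝ)..1, ∫ u in (0:ℝ)..1, F s u := by
    refine intervalIntegral.integral_congr fun s hs => ?_
    rw [uIcc_of_le zero_le_one] at hs
    simp only [hF]
    rw [qsKernel_inner_comp_sub, qsKernel_inner_extend hρ T hk hs, ← intervalIntegral.integral_const_mul]
  -- Step 2: Fubini on the square `(0,1] × (0,1]`
  have hint : Integrable (Function.uncurry F) ((volume.restrict (Ioc (0:ℝ) 1)).prod (volume.restrict (Ioc (0:ℝ) 1))) := by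
    have hI : IntegrableOn (Function.uncurry F) (Icc (0:ℝ) 1 ×ˢ Icc (0:ℝ) 1) (volume : Measure (ℝ × ℝ)) :=
      hFc.continuousOn.integrableOn_compact (isCompact_Icc.prod isCompact_Icc)
    have hI' := hI.mono_set (prod_mono (Ioc_subset_Icc_self) (Ioc_subset_Icc_self) :
      Ioc (0:ℝ) 1 ×ˢ Ioc (0:ℝ) 1 ⊆ Icc (0:ℝ) 1 ×ˢ Icc (0:ℝ) 1)
    rw [IntegrableOn, Measure.volume_eq_prod, ← Measure.prod_restrict] at hI'
    exact hI'
  have h2 : ∫ s in (0:ℝ)..1, ∫ u in (0:ℝ)..1, F s u = ∫ u in (0:ℝ)..1, ∫ s in (0:ℝ)..1, F s u := by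
    simp only [intervalIntegral.integral_of_le zero_le_one]
    exact integral_integral_swap hint
  -- Step 3: factor `k(Tu)` out of the inner `s`-integral
  have h3 : ∫ u in (0:ℝ)..1, ∫ s in (0:ℝ)..1, F s u = ∫ u in (0:ℝ)..1, rampAutocorr ρ u * k (T * u) := by
    refine intervalIntegral.integral_congr fun u _ => ?_
    simp only [hF, rampAutocorr]
    rw [← intervalIntegral.integral_mul_const]
    exact intervalIntegral.integral_congr fun s _ => (mul_assoc _ _ _).symm
  rw [h1, h2, h3]

/-- The autocorrelation is continuous in the lag. [folklore] -/
theorem continuous_rampAutocorr (ρ : ℝ) : Continuous (rampAutocorr ρ) := by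
  have h : Continuous (Function.uncurry fun u s : ℝ =>
      LatticeShear.LatticeWord.trapezoid 0 1 ρ s * LatticeShear.LatticeWord.trapezoid 0 1 ρ (s - u)) :=
    ((continuous_trapezoid_unit ρ).comp continuous_snd).mul
      ((continuous_trapezoid_unit ρ).comp (continuous_snd.sub continuous_fst))
  exact intervalIntegral.continuous_parametric_intervalIntegral_of_continuous (a₀ := 0) h continuous_const

/-- The autocorrelation is non-negative (`ρ`-ramps are non-negative). [folklore] -/
theorem rampAutocorr_nonneg (ρ u : ℝ) : 0 ≤ rampAutocorr ρ u :=
  intervalIntegral.integral_nonneg zero_le_one fun s _ =>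
    mul_nonneg (trapezoid_unit_nonneg ρ s) (trapezoid_unit_nonneg ρ (s - u))

/-- **The bilinear form of `qsResp` through the autocorrelation**:
`vᵀ f_T(B) w = T ∫₀¹ A(u) · vᵀ e^{−(Tu)B} w du`. [folklore] -/
theorem form_qsResp_eq_autocorr {ρ : ℝ} (hρ : 0 < ρ) (T : ℝ) (B : Matrix (Fin 3) (Fin 3) ℝ) (v w : Fin 3 → ℝ) :
    v ⬝ᵥ (qsResp ρ T B) *ᵥ w =
      T * ∫ u in (0:ℝ)..1, rampAutocorr ρ u * (v ⬝ᵥ (NormedSpace.exp (-((T * u) • B))) *ᵥ w) := by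
  rw [form_qsResp_eq]
  exact qsKernel_eq_autocorr hρ T (k := fun t => v ⬝ᵥ (NormedSpace.exp (-(t • B))) *ᵥ w)
    (continuous_const.dotProduct (continuous_exp_neg_smul_mulVec B w))

/-- The scalar slot response through the autocorrelation: `f_T(a) = T ∫₀¹ A(u) e^{−Tua} du`. [folklore] -/
theorem qsRespScalar_eq_autocorr {ρ : ℝ} (hρ : 0 < ρ) (T a : ℝ) :
    qsRespScalar ρ T a = T * ∫ u in (0:ℝ)..1, rampAutocorr ρ u * Real.exp (-(T * u) * a) := by
  unfold qsRespScalar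
  exact qsKernel_eq_autocorr hρ T (k := fun t => Real.exp (-t * a)) (by fun_prop)

/-- The first kernel moment through the autocorrelation: `g_T(a) = T ∫₀¹ A(u) (Tu) e^{−Tua} du`. [folklore] -/
theorem qsRespMoment_eq_autocorr {ρ : ℝ} (hρ : 0 < ρ) (T a : ℝ) :
    qsRespMoment ρ T a = T * ∫ u in (0:ℝ)..1, rampAutocorr ρ u * ((T * u) * Real.exp (-(T * u) * a)) := by
  unfold qsRespMoment
  exact qsKernel_eq_autocorr hρ T (k := fun t => t * Real.exp (-t * a)) (by fun_prop)

/-- Extension of the lag integral to the half-line (the autocorrelation kills `u ≥ 1`):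
`∫_{(0,∞)} A(u) k(Tu) du = ∫₀¹ A(u) k(Tu) du`. [folklore] -/
theorem autocorr_setIntegral_Ioi_eq {ρ : ℝ} (hρ : 0 < ρ) (T : ℝ) {k : ℝ → ℝ} (hk : Continuous k) :
    ∫ u in Ioi (0:ℝ), rampAutocorr ρ u * k (T * u) = ∫ u in (0:ℝ)..1, rampAutocorr ρ u * k (T * u) := by
  have hc : Continuous fun u => rampAutocorr ρ u * k (T * u) :=
    (continuous_rampAutocorr ρ).mul (hk.comp (continuous_const.mul continuous_id))
  have hzero : EqOn (fun u => rampAutocorr ρ u * k (T * u)) (fun _ => (0:ℝ)) (Ioi (1:ℝ)) := fun u hu => by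
    show rampAutocorr ρ u * k (T * u) = 0
    rw [rampAutocorr_eq_zero_of_one_le hρ (le_of_lt hu), zero_mul]
  have hI1 : IntegrableOn (fun u => rampAutocorr ρ u * k (T * u)) (Ioc (0:ℝ) 1) volume :=
    (hc.continuousOn.integrableOn_compact isCompact_Icc).mono_set Ioc_subset_Icc_self
  have hI2 : IntegrableOn (fun u => rampAutocorr ρ u * k (T * u)) (Ioi (1:ℝ)) volume :=
    integrableOn_zero.congr_fun hzero.symm measurableSet_Ioi
  rw [← Ioc_union_Ioi_eq_Ioi zero_le_one, setIntegral_union (Ioc_disjoint_Ioi_same) measurableSet_Ioi hI1 hI2,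
    setIntegral_congr_fun measurableSet_Ioi hzero, integral_zero, add_zero,
    intervalIntegral.integral_of_le zero_le_one]

/-- **Half-line autocorrelation form of the slot response in the scaled block `T·B`** (the starting point of `CosineMixture`):
`xᵀ f_T(B) z = T ∫_{(0,∞)} A(u) · xᵀ e^{−u(TB)} z du`. [folklore] -/
theorem form_qsResp_eq_autocorr_Ioi {ρ : ℝ} (hρ : 0 < ρ) (T : ℝ) (B : Matrix (Fin 3) (Fin 3) ℝ) (v w : Fin 3 → ℝ) :
    v ⬝ᵥ (qsResp ρ T B) *ᵥ w =
      T * ∫ u in Ioi (0:ℝ), rampAutocorr ρ u * (v ⬝ᵥ (NormedSpace.exp (-(u • (T • B)))) *ᵥ w) := by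
  have hk : Continuous fun t : ℝ => v ⬝ᵥ (NormedSpace.exp (-(t • B))) *ᵥ w :=
    continuous_const.dotProduct (continuous_exp_neg_smul_mulVec B w)
  have h := autocorr_setIntegral_Ioi_eq hρ T hk
  have e : ∀ u : ℝ, u • (T • B) = (T * u) • B := fun u => by rw [smul_smul, mul_comm]
  simp_rw [e]
  rw [form_qsResp_eq_autocorr hρ, ← h]

/-! ## The Laplace–cosine transform of the semigroup form is the RESOLVENT ATOM (second brick of `CosineMixture`) -/

section LaplaceCosine

private theorem dps_nonneg (v : Fin 3 → ℝ) : 0 ≤ v ⬝ᵥ v := by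
  unfold dotProduct; exact Finset.sum_nonneg fun i _ => mul_self_nonneg _

/-- Derivative of the semigroup form `u ↦ xᵀ e^{−uC} w`: `−xᵀ C e^{−uC} w`. [folklore] -/
theorem hasDerivAt_const_dotProduct_exp (C : Matrix (Fin 3) (Fin 3) ℝ) (x w : Fin 3 → ℝ) (u : ℝ) :
    HasDerivAt (fun u : ℝ => x ⬝ᵥ (NormedSpace.exp (-(u • C))) *ᵥ w)
      (-(x ⬝ᵥ C *ᵥ ((NormedSpace.exp (-(u • C))) *ᵥ w))) u := by
  have hg := hasDerivAt_exp_neg_smul_mulVec C w u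
  rw [hasDerivAt_pi] at hg
  have h := HasDerivAt.fun_sum (u := Finset.univ) fun i _ => (hg i).const_mul (x i)
  show HasDerivAt (fun u : ℝ => ∑ i, x i * ((NormedSpace.exp (-(u • C))) *ᵥ w) i) _ u
  refine h.congr_deriv ?_
  simp only [dotProduct, Pi.neg_apply, mul_neg, Finset.sum_neg_distrib]

/-- `C` commutes with its semigroup: `C e^{−uC} w = e^{−uC} C w`. [folklore] -/
theorem mulVec_exp_neg_smul_comm (C : Matrix (Fin 3) (Fin 3) ℝ) (w : Fin 3 → ℝ) (u : ℝ) :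
    C *ᵥ ((NormedSpace.exp (-(u • C))) *ᵥ w) = (NormedSpace.exp (-(u • C))) *ᵥ (C *ᵥ w) := by
  rw [Matrix.mulVec_mulVec, Matrix.mulVec_mulVec, (((Commute.refl C).smul_right u).neg_right).exp_right.eq]

/-- `C² + s` has unit determinant for `s ≥ 0` when `C` is coercive (`lo|x|² ≤ xᵀCx`, `lo > 0`). [folklore] -/
theorem isUnit_det_sq_add_of_coercive {C : Matrix (Fin 3) (Fin 3) ℝ} {lo s : ℝ} (hlo : 0 < lo) (hs : 0 ≤ s)
    (hco : ∀ x : Fin 3 → ℝ, lo * (x ⬝ᵥ x) ≤ x ⬝ᵥ C *ᵥ x) :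
    IsUnit (C * C + s • (1 : Matrix (Fin 3) (Fin 3) ℝ)).det := by
  rw [← Matrix.isUnit_iff_isUnit_det, ← Matrix.mulVec_injective_iff_isUnit]
  have hker : ∀ w : Fin 3 → ℝ, (C * C + s • (1 : Matrix (Fin 3) (Fin 3) ℝ)) *ᵥ w = 0 → w = 0 := by
    intro w hw
    have hw' : C *ᵥ (C *ᵥ w) = -(s • w) := by
      rw [Matrix.add_mulVec, Matrix.smul_mulVec, Matrix.one_mulVec, ← Matrix.mulVec_mulVec] at hw
      exact eq_neg_of_add_eq_zero_left hw
    set u := C *ᵥ w with hu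
    have h1 : u ⬝ᵥ C *ᵥ u = -(s * (w ⬝ᵥ C *ᵥ w)) := by
      rw [hw', dotProduct_neg, dotProduct_smul, smul_eq_mul, hu, dotProduct_comm (C *ᵥ w) w]
    have hwpos : 0 ≤ w ⬝ᵥ C *ᵥ w := le_trans (mul_nonneg hlo.le (dps_nonneg _)) (hco w)
    have hu0 : u ⬝ᵥ u ≤ 0 := by
      have := hco u
      have : lo * (u ⬝ᵥ u) ≤ 0 := by rw [h1] at this; nlinarith
      have huu : 0 ≤ u ⬝ᵥ u := dps_nonneg u
      nlinarith
    have huz : u = 0 := dotProduct_self_eq_zero.1 (le_antisymm hu0 (dps_nonneg _))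
    have hw0 : w ⬝ᵥ C *ᵥ w = 0 := by rw [← hu, huz, dotProduct_zero]
    have hww : lo * (w ⬝ᵥ w) ≤ 0 := by rw [← hw0]; exact hco w
    have hww' : w ⬝ᵥ w ≤ 0 := by
      have h0 : 0 ≤ w ⬝ᵥ w := dps_nonneg w
      nlinarith
    exact dotProduct_self_eq_zero.1 (le_antisymm hww' (dps_nonneg _))
  intro w₁ w₂ h
  have : (C * C + s • (1 : Matrix (Fin 3) (Fin 3) ℝ)) *ᵥ (w₁ - w₂) = 0 := by
    rw [Matrix.mulVec_sub, h, sub_self]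
  exact sub_eq_zero.1 (hker _ this)

/-- Bound on the semigroup form of a coercive block: `|xᵀe^{−uC}w| ≤ e^{−lo u}√(x·x)√(w·w)` (`u ≥ 0`). [folklore] -/
theorem abs_form_exp_le {C : Matrix (Fin 3) (Fin 3) ℝ} {lo : ℝ}
    (hco : ∀ x : Fin 3 → ℝ, lo * (x ⬝ᵥ x) ≤ x ⬝ᵥ C *ᵥ x) (x w : Fin 3 → ℝ) {u : ℝ} (hu : 0 ≤ u) :
    |x ⬝ᵥ (NormedSpace.exp (-(u • C))) *ᵥ w| ≤ Real.exp (-(lo * u)) * (Real.sqrt (x ⬝ᵥ x) * Real.sqrt (w ⬝ᵥ w)) := by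
  have hcs := abs_dotProduct_le_sqrt_mul_sqrt x ((NormedSpace.exp (-(u • C))) *ᵥ w)
  have hdec := sqrt_dotProduct_exp_le hco w hu
  calc |x ⬝ᵥ (NormedSpace.exp (-(u • C))) *ᵥ w|
      ≤ Real.sqrt (x ⬝ᵥ x) * Real.sqrt (((NormedSpace.exp (-(u • C))) *ᵥ w) ⬝ᵥ ((NormedSpace.exp (-(u • C))) *ᵥ w)) := hcs
    _ ≤ Real.sqrt (x ⬝ᵥ x) * (Real.exp (-(lo * u)) * Real.sqrt (w ⬝ᵥ w)) :=
        mul_le_mul_of_nonneg_left hdec (Real.sqrt_nonneg _)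
    _ = Real.exp (-(lo * u)) * (Real.sqrt (x ⬝ᵥ x) * Real.sqrt (w ⬝ᵥ w)) := by ring

/-- **LAPLACE–COSINE TRANSFORM = RESOLVENT ATOM.**  For a coercive block `C` (`lo|x|² ≤ xᵀCx`, `lo > 0`) and every `ξ`:
`u ↦ cos(ξu)·xᵀe^{−uC}z` is integrable on `(0, ∞)` and `∫₀^∞ cos(ξu)·xᵀe^{−uC}z du = xᵀ C(C² + ξ²)⁻¹ z`. [folklore] -/
theorem integral_Ioi_cos_mul_form_exp {C : Matrix (Fin 3) (Fin 3) ℝ} {lo : ℝ} (hlo : 0 < lo)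
    (hco : ∀ x : Fin 3 → ℝ, lo * (x ⬝ᵥ x) ≤ x ⬝ᵥ C *ᵥ x) (ξ : ℝ) (x z : Fin 3 → ℝ) :
    IntegrableOn (fun u : ℝ => Real.cos (ξ * u) * (x ⬝ᵥ (NormedSpace.exp (-(u • C))) *ᵥ z)) (Ioi 0) ∧
    ∫ u in Ioi (0:ℝ), Real.cos (ξ * u) * (x ⬝ᵥ (NormedSpace.exp (-(u • C))) *ᵥ z) =
      x ⬝ᵥ (C * (C * C + ξ ^ 2 • (1 : Matrix (Fin 3) (Fin 3) ℝ))⁻¹) *ᵥ z := by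
  set S : Matrix (Fin 3) (Fin 3) ℝ := C * C + ξ ^ 2 • (1 : Matrix (Fin 3) (Fin 3) ℝ) with hS
  have hunit : IsUnit S.det := isUnit_det_sq_add_of_coercive hlo (sq_nonneg ξ) hco
  -- the two orbits: `z' = S⁻¹ z`, `z'' = C z'`
  set z' : Fin 3 → ℝ := S⁻¹ *ᵥ z with hz'
  set z'' : Fin 3 → ℝ := C *ᵥ z' with hz''
  have hSz : C *ᵥ z'' + ξ ^ 2 • z' = z := by
    calc C *ᵥ z'' + ξ ^ 2 • z' = (C * C + ξ ^ 2 • (1 : Matrix (Fin 3) (Fin 3) ℝ)) *ᵥ z' := by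
          rw [Matrix.add_mulVec, Matrix.smul_mulVec, Matrix.one_mulVec, hz'', Matrix.mulVec_mulVec]
      _ = z := by rw [← hS, hz', Matrix.mulVec_mulVec, Matrix.mul_nonsing_inv _ hunit, Matrix.one_mulVec]
  -- the primitive `φ(u) = −cos(ξu)·xᵀe^{−uC}z'' + ξ sin(ξu)·xᵀe^{−uC}z'`
  set a : ℝ → ℝ := fun u => x ⬝ᵥ (NormedSpace.exp (-(u • C))) *ᵥ z'' with ha
  set b : ℝ → ℝ := fun u => x ⬝ᵥ (NormedSpace.exp (-(u • C))) *ᵥ z' with hb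
  set φ : ℝ → ℝ := fun u => -Real.cos (ξ * u) * a u + ξ * Real.sin (ξ * u) * b u with hφ
  set f : ℝ → ℝ := fun u => Real.cos (ξ * u) * (x ⬝ᵥ (NormedSpace.exp (-(u • C))) *ᵥ z) with hf
  -- derivative of the primitive
  have hderiv : ∀ u : ℝ, HasDerivAt φ (f u) u := by
    intro u
    have hA := hasDerivAt_const_dotProduct_exp C x z'' u
    have hB := hasDerivAt_const_dotProduct_exp C x z' u
    have hcos : HasDerivAt (fun u : ℝ => Real.cos (ξ * u)) (-Real.sin (ξ * u) * (ξ * 1)) u :=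
      ((hasDerivAt_id' u).const_mul ξ).cos
    have hsin : HasDerivAt (fun u : ℝ => Real.sin (ξ * u)) (Real.cos (ξ * u) * (ξ * 1)) u :=
      ((hasDerivAt_id' u).const_mul ξ).sin
    have h := (hcos.neg.mul hA).add ((hsin.const_mul ξ).mul hB)
    have hval : -(-Real.sin (ξ * u) * (ξ * 1)) * a u + -Real.cos (ξ * u) * -(x ⬝ᵥ C *ᵥ ((NormedSpace.exp (-(u • C))) *ᵥ z'')) +
        (ξ * (Real.cos (ξ * u) * (ξ * 1)) * b u + ξ * Real.sin (ξ * u) * -(x ⬝ᵥ C *ᵥ ((NormedSpace.exp (-(u • C))) *ᵥ z'))) = f u := by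
      have e1 : x ⬝ᵥ C *ᵥ ((NormedSpace.exp (-(u • C))) *ᵥ z') = a u := by
        rw [ha, mulVec_exp_neg_smul_comm]
      have e2 : Real.cos (ξ * u) * (x ⬝ᵥ C *ᵥ ((NormedSpace.exp (-(u • C))) *ᵥ z'')) + ξ ^ 2 * Real.cos (ξ * u) * b u = f u := by
        rw [hf, hb, mulVec_exp_neg_smul_comm]
        simp only
        rw [← hSz, Matrix.mulVec_add, Matrix.mulVec_smul, dotProduct_add, dotProduct_smul, smul_eq_mul]
        ring
      rw [e1, ← e2]; ring
    rw [hφ]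
    exact h.congr_deriv hval
  -- continuity, decay, integrability
  have hφc : Continuous φ := continuous_iff_continuousAt.2 fun u => (hderiv u).continuousAt
  have hfc : Continuous f := by
    rw [hf]
    exact (Real.continuous_cos.comp (continuous_const.mul continuous_id)).mul
      (continuous_const.dotProduct (continuous_exp_neg_smul_mulVec C z))
  have hfbound : ∀ u : ℝ, 0 ≤ u → ‖f u‖ ≤ Real.sqrt (x ⬝ᵥ x) * Real.sqrt (z ⬝ᵥ z) * Real.exp (-lo * u) := by
    intro u hu
    rw [hf, Real.norm_eq_abs]
    simp only
    rw [abs_mul]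
    have h1 : |Real.cos (ξ * u)| ≤ 1 := Real.abs_cos_le_one _
    have h2 := abs_form_exp_le hco x z hu
    have h3 : 0 ≤ Real.exp (-(lo * u)) * (Real.sqrt (x ⬝ᵥ x) * Real.sqrt (z ⬝ᵥ z)) := by positivity
    calc |Real.cos (ξ * u)| * |x ⬝ᵥ (NormedSpace.exp (-(u • C))) *ᵥ z|
        ≤ 1 * (Real.exp (-(lo * u)) * (Real.sqrt (x ⬝ᵥ x) * Real.sqrt (z ⬝ᵥ z))) :=
          mul_le_mul h1 h2 (abs_nonneg _) zero_le_one
      _ = Real.sqrt (x ⬝ᵥ x) * Real.sqrt (z ⬝ᵥ z) * Real.exp (-lo * u) := by rw [neg_mul]; ring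
  have hfint : IntegrableOn f (Ioi 0) := by
    refine Integrable.mono' (((exp_neg_integrableOn_Ioi 0 hlo).const_mul (Real.sqrt (x ⬝ᵥ x) * Real.sqrt (z ⬝ᵥ z))))
      hfc.aestronglyMeasurable ?_
    filter_upwards [ae_restrict_mem measurableSet_Ioi] with u hu
    exact hfbound u (le_of_lt hu)
  have hφlim : Filter.Tendsto φ Filter.atTop (nhds 0) := by
    have hK : Filter.Tendsto (fun u : ℝ => (Real.sqrt (x ⬝ᵥ x) * Real.sqrt (z'' ⬝ᵥ z'') +
        |ξ| * (Real.sqrt (x ⬝ᵥ x) * Real.sqrt (z' ⬝ᵥ z'))) * Real.exp (-(lo * u))) Filter.atTop (nhds 0) := by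
      have h0 : Filter.Tendsto (fun u : ℝ => Real.exp (-(lo * u))) Filter.atTop (nhds 0) := by
        have := Real.tendsto_exp_atBot.comp (Filter.tendsto_neg_atTop_atBot.comp (Filter.tendsto_id.const_mul_atTop hlo))
        exact this
      simpa using h0.const_mul (Real.sqrt (x ⬝ᵥ x) * Real.sqrt (z'' ⬝ᵥ z'') + |ξ| * (Real.sqrt (x ⬝ᵥ x) * Real.sqrt (z' ⬝ᵥ z')))
    refine squeeze_zero_norm' ?_ hK
    filter_upwards [Filter.eventually_ge_atTop (0:ℝ)] with u hu
    rw [hφ, Real.norm_eq_abs]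
    simp only
    have h1 := abs_form_exp_le hco x z'' hu
    have h2 := abs_form_exp_le hco x z' hu
    have hc1 : |Real.cos (ξ * u)| ≤ 1 := Real.abs_cos_le_one _
    have hs1 : |Real.sin (ξ * u)| ≤ 1 := Real.abs_sin_le_one _
    calc |-Real.cos (ξ * u) * a u + ξ * Real.sin (ξ * u) * b u|
        ≤ |-Real.cos (ξ * u) * a u| + |ξ * Real.sin (ξ * u) * b u| := abs_add_le _ _
      _ = |Real.cos (ξ * u)| * |a u| + |ξ| * |Real.sin (ξ * u)| * |b u| := by
          rw [abs_mul, abs_mul, abs_mul, abs_neg]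
      _ ≤ 1 * (Real.exp (-(lo * u)) * (Real.sqrt (x ⬝ᵥ x) * Real.sqrt (z'' ⬝ᵥ z''))) +
          |ξ| * 1 * (Real.exp (-(lo * u)) * (Real.sqrt (x ⬝ᵥ x) * Real.sqrt (z' ⬝ᵥ z'))) := by
          exact add_le_add (mul_le_mul hc1 h1 (abs_nonneg _) zero_le_one)
            (mul_le_mul (mul_le_mul_of_nonneg_left hs1 (abs_nonneg ξ)) h2 (abs_nonneg _) (by positivity))
      _ = (Real.sqrt (x ⬝ᵥ x) * Real.sqrt (z'' ⬝ᵥ z'') + |ξ| * (Real.sqrt (x ⬝ᵥ x) * Real.sqrt (z' ⬝ᵥ z'))) *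
          Real.exp (-(lo * u)) := by ring
  -- the fundamental theorem on `(0, ∞)`
  have hFTC := integral_Ioi_of_hasDerivAt_of_tendsto (a := 0) (f := φ) (f' := f) (m := 0)
    hφc.continuousWithinAt (fun u _ => hderiv u) hfint hφlim
  have ha0 : a 0 = x ⬝ᵥ (C * S⁻¹) *ᵥ z := by
    rw [ha]
    simp only [zero_smul, neg_zero, NormedSpace.exp_zero, Matrix.one_mulVec]
    try rw [hz'', hz', Matrix.mulVec_mulVec]
  have hφ0 : φ 0 = -(x ⬝ᵥ (C * S⁻¹) *ᵥ z) := by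
    rw [hφ]
    simp only [mul_zero, Real.cos_zero, Real.sin_zero, zero_mul, add_zero]
    rw [ha0]
    ring
  refine ⟨hfint, ?_⟩
  rw [hFTC, hφ0, zero_sub, neg_neg]

end LaplaceCosine

/-! ## §12 Fourier side: boxes, `|𝓕 box|²`, the trapezoid as a box convolution, `𝓕` of the autocorrelation -/

section FourierSide

open scoped FourierTransform Convolution Real

/-- The box `𝟙_{[0, L]}` as a complex-valued function. [folklore] -/
noncomputable def boxC (L : ℝ) : ℝ → ℂ := (Icc (0:ℝ) L).indicator fun _ => (1:ℂ)

/-- The box is integrable. [folklore] -/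
theorem integrable_boxC (L : ℝ) : Integrable (boxC L) :=
  ((continuous_const (y := (1:ℂ))).continuousOn.integrableOn_compact isCompact_Icc).integrable_indicator
    measurableSet_Icc

/-- The Fourier transform of the box as an interval integral: `𝓕 𝟙_{[0,L]}(ξ) = ∫₀ᴸ e^{−2πiξt} dt`. [folklore] -/
theorem fourier_boxC_eq_intervalIntegral {L : ℝ} (hL : 0 ≤ L) (ξ : ℝ) :
    𝓕 (boxC L) ξ = ∫ t in (0:ℝ)..L, Complex.exp ((-2 * π * ξ * Complex.I) * t) := by
  rw [Real.fourier_real_eq_integral_exp_smul]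
  have h : (fun v : ℝ => Complex.exp (↑(-2 * π * v * ξ) * Complex.I) • boxC L v) =
      (Icc (0:ℝ) L).indicator (fun v : ℝ => Complex.exp ((-2 * π * ξ * Complex.I) * v)) := by
    funext v
    by_cases hv : v ∈ Icc (0:ℝ) L
    · rw [boxC, indicator_of_mem hv, indicator_of_mem hv, smul_eq_mul, mul_one]
      congr 1
      push_cast
      ring
    · rw [boxC, indicator_of_notMem hv, indicator_of_notMem hv, smul_zero]
  rw [h, integral_indicator measurableSet_Icc, integral_Icc_eq_integral_Ioc, ← intervalIntegral.integral_of_le hL]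

/-- **The Fourier transform of the box** (`ξ ≠ 0`): `𝓕 𝟙_{[0,L]}(ξ) = (e^{−2πiξL} − 1)/(−2πiξ)`. [folklore] -/
theorem fourier_boxC {L : ℝ} (hL : 0 ≤ L) {ξ : ℝ} (hξ : ξ ≠ 0) :
    𝓕 (boxC L) ξ = (Complex.exp ((-2 * π * ξ * Complex.I) * L) - 1) / (-2 * π * ξ * Complex.I) := by
  have hc : (-2 * π * ξ * Complex.I : ℂ) ≠ 0 := by
    have hπ : (π : ℂ) ≠ 0 := Complex.ofReal_ne_zero.2 Real.pi_ne_zero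
    have hξ' : (ξ : ℂ) ≠ 0 := Complex.ofReal_ne_zero.2 hξ
    simp [hπ, hξ', Complex.I_ne_zero]
  rw [fourier_boxC_eq_intervalIntegral hL, integral_exp_mul_complex hc]
  simp

/-- **`|𝓕 box|²`**: `𝓕 𝟙_{[0,L]}(ξ) · 𝓕 𝟙_{[0,L]}(−ξ) = sin²(πLξ)/(π²ξ²)` (`ξ ≠ 0`). [folklore] -/
theorem fourier_boxC_mul_neg {L : ℝ} (hL : 0 ≤ L) {ξ : ℝ} (hξ : ξ ≠ 0) :
    𝓕 (boxC L) ξ * 𝓕 (boxC L) (-ξ) = ((Real.sin (π * L * ξ) ^ 2 / (π ^ 2 * ξ ^ 2) : ℝ) : ℂ) := by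
  rw [fourier_boxC hL hξ, fourier_boxC hL (neg_ne_zero.2 hξ), div_mul_div_comm]
  have e1 : (-2 * π * ξ * Complex.I) * L = -((2 * π * L * ξ : ℝ) : ℂ) * Complex.I := by push_cast; ring
  have e2 : (-2 * π * ((-ξ : ℝ) : ℂ) * Complex.I) * L = ((2 * π * L * ξ : ℝ) : ℂ) * Complex.I := by push_cast; ring
  have num : (Complex.exp ((-2 * π * ξ * Complex.I) * L) - 1) * (Complex.exp ((-2 * π * ((-ξ : ℝ) : ℂ) * Complex.I) * L) - 1) =
      2 - 2 * Complex.cos ((2 * π * L * ξ : ℝ) : ℂ) := by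
    rw [e1, e2]
    have hc := Complex.two_cos (((2 * π * L * ξ : ℝ) : ℂ))
    have hprod : Complex.exp (-((2 * π * L * ξ : ℝ) : ℂ) * Complex.I) * Complex.exp (((2 * π * L * ξ : ℝ) : ℂ) * Complex.I) = 1 := by
      rw [← Complex.exp_add]; simp
    linear_combination hprod + hc
  have den : (-2 * π * ξ * Complex.I) * (-2 * π * ((-ξ : ℝ) : ℂ) * Complex.I) = 4 * (π : ℂ) ^ 2 * (ξ : ℂ) ^ 2 := by
    push_cast
    linear_combination (-4 * (π : ℂ) ^ 2 * (ξ : ℂ) ^ 2) * Complex.I_mul_I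
  rw [num, den]
  have hπ : (π : ℂ) ≠ 0 := Complex.ofReal_ne_zero.2 Real.pi_ne_zero
  have hξ' : (ξ : ℂ) ≠ 0 := Complex.ofReal_ne_zero.2 hξ
  push_cast
  rw [show (2 : ℂ) * ↑π * ↑L * ↑ξ = 2 * (↑π * ↑L * ↑ξ) by ring, Complex.cos_two_mul, Complex.cos_sq']
  field_simp
  ring

/-- `𝟙_{[0,L]}(x − t) = 𝟙_{[x−L, x]}(t)`. [folklore] -/
theorem boxC_sub (L x t : ℝ) : boxC L (x - t) = (Icc (x - L) x).indicator (fun _ => (1:ℂ)) t := by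
  unfold boxC
  by_cases h : t ∈ Icc (x - L) x
  · have h' : x - t ∈ Icc (0:ℝ) L := ⟨by linarith [h.2], by linarith [h.1]⟩
    rw [indicator_of_mem h', indicator_of_mem h]
  · have h' : x - t ∉ Icc (0:ℝ) L := fun h' => h ⟨by linarith [h'.2], by linarith [h'.1]⟩
    rw [indicator_of_notMem h', indicator_of_notMem h]

/-- The box–box overlap integrand is the indicator of the overlap. [folklore] -/
theorem boxC_mul_boxC_sub (ρ x t : ℝ) :
    boxC ρ t * boxC (1 - ρ) (x - t) = (Icc (0:ℝ) ρ ∩ Icc (x - (1 - ρ)) x).indicator (fun _ => (1:ℂ)) t := by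
  rw [boxC_sub]
  unfold boxC
  by_cases h1 : t ∈ Icc (0:ℝ) ρ <;> by_cases h2 : t ∈ Icc (x - (1 - ρ)) x <;>
    simp [indicator_apply, h1, h2, mem_inter_iff]

/-- The box–box overlap has length `max (min ρ x − max 0 (x − (1−ρ))) 0`. [folklore] -/
theorem integral_boxC_mul_boxC_sub (ρ x : ℝ) :
    ∫ t, boxC ρ t * boxC (1 - ρ) (x - t) = ((max (min ρ x - max 0 (x - (1 - ρ))) 0 : ℝ) : ℂ) := by
  have h : (fun t => boxC ρ t * boxC (1 - ρ) (x - t)) =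
      (Icc (0:ℝ) ρ ∩ Icc (x - (1 - ρ)) x).indicator (fun _ => (1:ℂ)) := funext (boxC_mul_boxC_sub ρ x)
  rw [h, integral_indicator_const (1:ℂ) (measurableSet_Icc.inter measurableSet_Icc), Icc_inter_Icc,
    Real.volume_real_Icc, Complex.real_smul, mul_one]

/-- The overlap length IS `ρ ×` the unit ramp profile (`0 < ρ ≤ 1/2`). [folklore] -/
theorem trapezoid_eq_overlap {ρ : ℝ} (hρ : 0 < ρ) (hρ2 : ρ ≤ 1 / 2) (x : ℝ) :
    ρ * LatticeShear.LatticeWord.trapezoid 0 1 ρ x = max (min ρ x - max 0 (x - (1 - ρ))) 0 := by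
  unfold LatticeShear.LatticeWord.trapezoid
  rw [sub_zero, mul_one, zero_add]
  -- both sides equal `max 0 (min ρ (min x (1 - x)))`
  have lhs : ρ * max 0 (min 1 (min (x / ρ) ((1 - x) / ρ))) = max 0 (min ρ (min x (1 - x))) := by
    rw [mul_max_of_nonneg _ _ hρ.le, mul_zero, mul_min_of_nonneg _ _ hρ.le, mul_one, mul_min_of_nonneg _ _ hρ.le,
      mul_div_cancel₀ _ hρ.ne', mul_div_cancel₀ _ hρ.ne']
  rw [lhs]
  rcases le_or_gt x (1 - ρ) with h | h
  · have e1 : max 0 (x - (1 - ρ)) = 0 := max_eq_left (by linarith)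
    have e2 : min ρ (min x (1 - x)) = min ρ x := by
      rw [← min_assoc]
      exact min_eq_left (le_trans (min_le_left _ _) (by linarith))
    rw [e1, e2, sub_zero, max_comm]
  · have e1 : max 0 (x - (1 - ρ)) = x - (1 - ρ) := max_eq_right (by linarith)
    have e2 : min ρ x = ρ := min_eq_left (by linarith)
    have e3 : min ρ (min x (1 - x)) = 1 - x := by
      rw [min_eq_right (by linarith : 1 - x ≤ x)]
      exact min_eq_right (by linarith)
    rw [e1, e2, e3, max_comm]
    congr 1
    ring

/-- The unit ramp profile as a complex-valued function. [folklore] -/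
noncomputable def trapC (ρ : ℝ) : ℝ → ℂ := fun s => ((LatticeShear.LatticeWord.trapezoid 0 1 ρ s : ℝ) : ℂ)

/-- **The ramp profile is a box convolution**: `a = ρ⁻¹ · 𝟙_{[0,ρ]} ⋆ 𝟙_{[0,1−ρ]}` (`0 < ρ ≤ 1/2`). [folklore] -/
theorem trapC_eq_smul_conv {ρ : ℝ} (hρ : 0 < ρ) (hρ2 : ρ ≤ 1 / 2) :
    trapC ρ = (ρ⁻¹ : ℂ) • (boxC ρ ⋆[ContinuousLinearMap.mul ℂ ℂ, volume] boxC (1 - ρ)) := by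
  funext x
  rw [Pi.smul_apply, convolution_def]
  simp_rw [ContinuousLinearMap.mul_apply']
  rw [integral_boxC_mul_boxC_sub, ← trapezoid_eq_overlap hρ hρ2, trapC, smul_eq_mul]
  have hρ' : (ρ : ℂ) ≠ 0 := Complex.ofReal_ne_zero.2 hρ.ne'
  push_cast
  field_simp

/-- The ramp profile is continuous with support in `[0, 1]`, hence integrable. [folklore] -/
theorem integrable_trapC {ρ : ℝ} (hρ : 0 < ρ) : Integrable (trapC ρ) := by
  have hc : Continuous (trapC ρ) := Complex.continuous_ofReal.comp (continuous_trapezoid_unit ρ)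
  refine hc.integrable_of_hasCompactSupport
    (HasCompactSupport.intro (K := Icc (0:ℝ) 1) isCompact_Icc fun x (hx : x ∉ Icc (0:ℝ) 1) => ?_)
  simp only [trapC, Complex.ofReal_eq_zero]
  rcases lt_or_gt_of_ne (show x ≠ 0 from fun h => hx (by rw [h]; exact ⟨le_refl 0, zero_le_one⟩)) with h0 | h0
  · exact trapezoid_unit_eq_zero_of_nonpos hρ h0.le
  · by_cases h1 : 1 ≤ x
    · exact trapezoid_unit_eq_zero_of_one_le hρ h1
    · exact absurd ⟨h0.le, (not_le.1 h1).le⟩ hx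

/-- **The autocorrelation is the autoconvolution** `A = a ⋆ a(−·)` (as complex functions on `ℝ`). [folklore] -/
theorem rampAutocorr_eq_conv {ρ : ℝ} (hρ : 0 < ρ) (u : ℝ) :
    ((rampAutocorr ρ u : ℝ) : ℂ) = (trapC ρ ⋆[ContinuousLinearMap.mul ℂ ℂ, volume] (fun s => trapC ρ (-s))) u := by
  rw [convolution_def]
  simp_rw [ContinuousLinearMap.mul_apply', neg_sub]
  have h : (fun t => trapC ρ t * trapC ρ (t - u)) = (Icc (0:ℝ) 1).indicator (fun t => trapC ρ t * trapC ρ (t - u)) := by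
    funext t
    by_cases ht : t ∈ Icc (0:ℝ) 1
    · rw [indicator_of_mem ht]
    · rw [indicator_of_notMem ht]
      have hz : LatticeShear.LatticeWord.trapezoid 0 1 ρ t = 0 := by
        rcases lt_or_ge t 0 with h0 | h0
        · exact trapezoid_unit_eq_zero_of_nonpos hρ h0.le
        · exact trapezoid_unit_eq_zero_of_one_le hρ (le_of_lt (not_le.1 fun h1 => ht ⟨h0, h1⟩))
      simp [trapC, hz]
  rw [h, integral_indicator measurableSet_Icc, integral_Icc_eq_integral_Ioc, ← intervalIntegral.integral_of_le zero_le_one,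
    rampAutocorr]
  simp only [trapC]
  simp_rw [← Complex.ofReal_mul]
  rw [intervalIntegral.integral_ofReal]

/-- `𝓕 (c · g) = c · 𝓕 g` (scalar `c : ℂ`). [folklore] -/
theorem fourier_const_smul' (c : ℂ) (g : ℝ → ℂ) (ξ : ℝ) : 𝓕 (c • g) ξ = c * 𝓕 g ξ := by
  rw [Real.fourier_real_eq, Real.fourier_real_eq, ← integral_const_mul]
  congr 1
  funext v
  rw [Pi.smul_apply, smul_eq_mul, Circle.smul_def, Circle.smul_def]
  ring

/-- `𝓕 a = ρ⁻¹ · 𝓕 𝟙_{[0,ρ]} · 𝓕 𝟙_{[0,1−ρ]}`. [folklore] -/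
theorem fourier_trapC {ρ : ℝ} (hρ : 0 < ρ) (hρ2 : ρ ≤ 1 / 2) (ξ : ℝ) :
    𝓕 (trapC ρ) ξ = (ρ⁻¹ : ℂ) * (𝓕 (boxC ρ) ξ * 𝓕 (boxC (1 - ρ)) ξ) := by
  rw [trapC_eq_smul_conv hρ hρ2, fourier_const_smul',
    Real.fourier_mul_convolution_eq (integrable_boxC ρ) (integrable_boxC (1 - ρ)) ξ]

/-- `𝓕 (a(−·))(ξ) = 𝓕 a (−ξ)`. [folklore] -/
theorem fourier_trapC_flip (ρ ξ : ℝ) : 𝓕 (fun s => trapC ρ (-s)) ξ = 𝓕 (trapC ρ) (-ξ) := by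
  rw [← Real.fourierInv_eq_fourier_neg, Real.fourierInv_eq_fourier_comp_neg]

/-- The explicit spectral density of the ramp autocorrelation in Mathlib's `𝓕` normalisation:
`sin²(πρξ) sin²(π(1−ρ)ξ) / (ρ²π⁴ξ⁴)` (`= slotSpec ρ (2πξ)`). [folklore] -/
noncomputable def trapSpec (ρ ξ : ℝ) : ℝ :=
  Real.sin (π * ρ * ξ) ^ 2 * Real.sin (π * (1 - ρ) * ξ) ^ 2 / (ρ ^ 2 * π ^ 4 * ξ ^ 4)

/-- The autocorrelation as a complex-valued function. [folklore] -/
noncomputable def rampAutocorrC (ρ : ℝ) : ℝ → ℂ := fun u => ((rampAutocorr ρ u : ℝ) : ℂ)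

/-- **`𝓕 A = |𝓕 a|²` explicitly**: `𝓕 A(ξ) = sin²(πρξ) sin²(π(1−ρ)ξ)/(ρ²π⁴ξ⁴)` for `ξ ≠ 0` (`0 < ρ ≤ 1/2`). [folklore] -/
theorem fourier_rampAutocorrC {ρ : ℝ} (hρ : 0 < ρ) (hρ2 : ρ ≤ 1 / 2) {ξ : ℝ} (hξ : ξ ≠ 0) :
    𝓕 (rampAutocorrC ρ) ξ = ((trapSpec ρ ξ : ℝ) : ℂ) := by
  have hA : rampAutocorrC ρ = trapC ρ ⋆[ContinuousLinearMap.mul ℂ ℂ, volume] (fun s => trapC ρ (-s)) :=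
    funext (rampAutocorr_eq_conv hρ)
  rw [hA, Real.fourier_mul_convolution_eq (integrable_trapC hρ) ((integrable_trapC hρ).comp_neg) ξ,
    fourier_trapC_flip, fourier_trapC hρ hρ2, fourier_trapC hρ hρ2]
  have h1 := fourier_boxC_mul_neg hρ.le hξ
  have h2 := fourier_boxC_mul_neg (by linarith : (0:ℝ) ≤ 1 - ρ) hξ
  have hρ' : (ρ : ℂ) ≠ 0 := Complex.ofReal_ne_zero.2 hρ.ne'
  calc (ρ⁻¹ : ℂ) * (𝓕 (boxC ρ) ξ * 𝓕 (boxC (1 - ρ)) ξ) * ((ρ⁻¹ : ℂ) * (𝓕 (boxC ρ) (-ξ) * 𝓕 (boxC (1 - ρ)) (-ξ)))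
      = (ρ⁻¹ : ℂ) ^ 2 * ((𝓕 (boxC ρ) ξ * 𝓕 (boxC ρ) (-ξ)) * (𝓕 (boxC (1 - ρ)) ξ * 𝓕 (boxC (1 - ρ)) (-ξ))) := by ring
    _ = ((trapSpec ρ ξ : ℝ) : ℂ) := by
      rw [h1, h2, trapSpec]
      push_cast
      field_simp

end FourierSide

/-! ## §13 Fourier inversion: `A(u) = ∫ cos(2πξu)·trapSpec(ξ) dξ = (1/π)∫₀^∞ slotSpec(η) cos(ηu) dη` -/

section Inversion

open scoped FourierTransform Convolution Real

theorem trapSpec_nonneg (ρ ξ : ℝ) : 0 ≤ trapSpec ρ ξ := by unfold trapSpec; positivity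

/-- The majorant `trapSpec ≤ 2(1 + ξ²)⁻¹` (`0 < ρ ≤ 1`). [folklore] -/
theorem trapSpec_le {ρ : ℝ} (hρ : 0 < ρ) (hρ1 : ρ ≤ 1) (ξ : ℝ) : trapSpec ρ ξ ≤ 2 * (1 + ξ ^ 2)⁻¹ := by
  unfold trapSpec
  rcases eq_or_ne ξ 0 with h0 | h0
  · subst h0; norm_num
  have h1 : Real.sin (π * ρ * ξ) ^ 2 ≤ (π * ρ * ξ) ^ 2 := Real.sin_sq_le_sq
  have h2 : Real.sin (π * (1 - ρ) * ξ) ^ 2 ≤ (π * (1 - ρ) * ξ) ^ 2 := Real.sin_sq_le_sq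
  have h3 : Real.sin (π * (1 - ρ) * ξ) ^ 2 ≤ 1 := Real.sin_sq_le_one _
  have hπ : 1 ≤ π := by linarith [Real.pi_gt_three]
  have hξ2 : 0 < ξ ^ 2 := by positivity
  have hD : 0 < ρ ^ 2 * π ^ 4 * ξ ^ 4 := by positivity
  rw [div_le_iff₀ hD, ← div_eq_mul_inv, div_mul_eq_mul_div, le_div_iff₀ (by positivity)]
  -- sin₁² sin₂² (1 + ξ²) ≤ 2 ρ²π⁴ξ⁴
  have hs2 : Real.sin (π * (1 - ρ) * ξ) ^ 2 * (1 + ξ ^ 2) ≤ 2 * (π ^ 2 * ξ ^ 2) := by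
    have a1 : Real.sin (π * (1 - ρ) * ξ) ^ 2 ≤ π ^ 2 * ξ ^ 2 := by
      calc Real.sin (π * (1 - ρ) * ξ) ^ 2 ≤ (π * (1 - ρ) * ξ) ^ 2 := h2
        _ = (1 - ρ) ^ 2 * (π ^ 2 * ξ ^ 2) := by ring
        _ ≤ 1 * (π ^ 2 * ξ ^ 2) := by
          apply mul_le_mul_of_nonneg_right _ (by positivity)
          nlinarith
        _ = π ^ 2 * ξ ^ 2 := one_mul _
    have a2 : Real.sin (π * (1 - ρ) * ξ) ^ 2 * ξ ^ 2 ≤ π ^ 2 * ξ ^ 2 := by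
      calc Real.sin (π * (1 - ρ) * ξ) ^ 2 * ξ ^ 2 ≤ 1 * ξ ^ 2 := mul_le_mul_of_nonneg_right h3 hξ2.le
        _ ≤ π ^ 2 * ξ ^ 2 := by apply mul_le_mul_of_nonneg_right _ hξ2.le; nlinarith
    nlinarith
  calc Real.sin (π * ρ * ξ) ^ 2 * Real.sin (π * (1 - ρ) * ξ) ^ 2 * (1 + ξ ^ 2)
      = Real.sin (π * ρ * ξ) ^ 2 * (Real.sin (π * (1 - ρ) * ξ) ^ 2 * (1 + ξ ^ 2)) := by ring
    _ ≤ (π * ρ * ξ) ^ 2 * (2 * (π ^ 2 * ξ ^ 2)) :=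
        mul_le_mul h1 hs2 (by positivity) (by positivity)
    _ = 2 * (ρ ^ 2 * π ^ 4 * ξ ^ 4) := by ring

theorem measurable_trapSpec (ρ : ℝ) : Measurable (fun ξ : ℝ => trapSpec ρ ξ) := by
  unfold trapSpec
  fun_prop

/-- The spectral density is integrable. [folklore] -/
theorem integrable_trapSpec {ρ : ℝ} (hρ : 0 < ρ) (hρ1 : ρ ≤ 1) : Integrable (fun ξ : ℝ => trapSpec ρ ξ) := by
  refine Integrable.mono' (integrable_inv_one_add_sq.const_mul 2) (measurable_trapSpec ρ).aestronglyMeasurable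
    (Filter.Eventually.of_forall fun ξ => ?_)
  rw [Real.norm_eq_abs, abs_of_nonneg (trapSpec_nonneg ρ ξ)]
  exact trapSpec_le hρ hρ1 ξ

theorem continuous_rampAutocorrC (ρ : ℝ) : Continuous (rampAutocorrC ρ) :=
  Complex.continuous_ofReal.comp (continuous_rampAutocorr ρ)

theorem integrable_rampAutocorrC {ρ : ℝ} (hρ : 0 < ρ) : Integrable (rampAutocorrC ρ) := by
  have hA : rampAutocorrC ρ = trapC ρ ⋆[ContinuousLinearMap.mul ℂ ℂ, volume] (fun s => trapC ρ (-s)) :=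
    funext (rampAutocorr_eq_conv hρ)
  rw [hA]
  exact (integrable_trapC hρ).integrable_convolution _ ((integrable_trapC hρ).comp_neg)

/-- `𝓕 A = trapSpec` almost everywhere. [folklore] -/
theorem fourier_rampAutocorrC_ae {ρ : ℝ} (hρ : 0 < ρ) (hρ2 : ρ ≤ 1 / 2) :
    𝓕 (rampAutocorrC ρ) =ᵐ[volume] fun ξ => ((trapSpec ρ ξ : ℝ) : ℂ) := by
  have h : ({(0:ℝ)}ᶜ : Set ℝ) ∈ ae (volume : Measure ℝ) := compl_mem_ae_iff.2 (measure_singleton 0)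
  filter_upwards [h] with ξ hξ
  exact fourier_rampAutocorrC hρ hρ2 (by simpa using hξ)

theorem integrable_fourier_rampAutocorrC {ρ : ℝ} (hρ : 0 < ρ) (hρ2 : ρ ≤ 1 / 2) :
    Integrable (𝓕 (rampAutocorrC ρ)) :=
  ((integrable_trapSpec hρ (by linarith)).ofReal).congr (fourier_rampAutocorrC_ae hρ hρ2).symm

/-- **FOURIER INVERSION for the ramp autocorrelation**: `A(u) = ∫_ℝ cos(2πξu)·trapSpec ρ ξ dξ` (`0 < ρ ≤ 1/2`, all `u`). [folklore] -/
theorem rampAutocorr_eq_integral_trapSpec {ρ : ℝ} (hρ : 0 < ρ) (hρ2 : ρ ≤ 1 / 2) (u : ℝ) :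
    rampAutocorr ρ u = ∫ ξ, Real.cos (2 * π * (ξ * u)) * trapSpec ρ ξ := by
  have hinv := congrFun ((continuous_rampAutocorrC ρ).fourierInv_fourier_eq (integrable_rampAutocorrC hρ)
    (integrable_fourier_rampAutocorrC hρ hρ2)) u
  have h1 : (𝓕⁻ (𝓕 (rampAutocorrC ρ)) : ℝ → ℂ) u =
      ∫ ξ, Complex.exp (↑(2 * π * (ξ * u)) * Complex.I) * ((trapSpec ρ ξ : ℝ) : ℂ) := by
    rw [Literature.Analysis.Fourier.fourierInv_real_eq]
    refine integral_congr_ae ?_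
    filter_upwards [fourier_rampAutocorrC_ae hρ hρ2] with ξ hξ
    rw [hξ, Circle.smul_def, Real.fourierChar_apply, smul_eq_mul]
  have hint : Integrable (fun ξ : ℝ => Complex.exp (↑(2 * π * (ξ * u)) * Complex.I) * ((trapSpec ρ ξ : ℝ) : ℂ)) := by
    refine ((integrable_trapSpec hρ (by linarith)).ofReal).bdd_mul' (c := 1) ?_ (Filter.Eventually.of_forall fun ξ => ?_)
    · exact (Complex.continuous_exp.comp ((Complex.continuous_ofReal.comp (by fun_prop)).mul continuous_const)).aestronglyMeasurable
    · rw [Complex.norm_exp_ofReal_mul_I]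
  have h2 : (∫ ξ, Complex.exp (↑(2 * π * (ξ * u)) * Complex.I) * ((trapSpec ρ ξ : ℝ) : ℂ)).re =
      ∫ ξ, Real.cos (2 * π * (ξ * u)) * trapSpec ρ ξ := by
    have h := integral_re hint
    simp only [RCLike.re_to_complex] at h
    rw [← h]
    refine integral_congr_ae (Filter.Eventually.of_forall fun ξ => ?_)
    show (Complex.exp (↑(2 * π * (ξ * u)) * Complex.I) * ↑(trapSpec ρ ξ)).re = Real.cos (2 * π * (ξ * u)) * trapSpec ρ ξ
    rw [Complex.re_mul_ofReal, Complex.exp_ofReal_mul_I_re]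
  calc rampAutocorr ρ u = (rampAutocorrC ρ u).re := by simp [rampAutocorrC]
    _ = ((𝓕⁻ (𝓕 (rampAutocorrC ρ)) : ℝ → ℂ) u).re := by rw [hinv]
    _ = ∫ ξ, Real.cos (2 * π * (ξ * u)) * trapSpec ρ ξ := by rw [h1, h2]

/-- The slot spectral weight in the `η = 2πξ` normalisation: `Â_ρ(η) = 16 sin²(ρη/2) sin²((1−ρ)η/2)/(ρ²η⁴)`. -/
noncomputable def slotSpec (ρ ξ : ℝ) : ℝ := 16 * Real.sin (ρ * ξ / 2) ^ 2 * Real.sin ((1 - ρ) * ξ / 2) ^ 2 / (ρ ^ 2 * ξ ^ 4)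

theorem slotSpec_nonneg (ρ ξ : ℝ) : 0 ≤ slotSpec ρ ξ := by unfold slotSpec; positivity

theorem slotSpec_two_pi_mul (ρ ξ : ℝ) : slotSpec ρ (2 * π * ξ) = trapSpec ρ ξ := by
  unfold slotSpec trapSpec
  rw [show ρ * (2 * π * ξ) / 2 = π * ρ * ξ by ring, show (1 - ρ) * (2 * π * ξ) / 2 = π * (1 - ρ) * ξ by ring,
    show ρ ^ 2 * (2 * π * ξ) ^ 4 = 16 * (ρ ^ 2 * π ^ 4 * ξ ^ 4) by ring, mul_assoc (16:ℝ),
    mul_div_mul_left _ _ (by norm_num : (16:ℝ) ≠ 0)]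

/-- **THE COSINE REPRESENTATION**: `A(u) = (1/π)∫₀^∞ Â_ρ(η) cos(ηu) dη` (`0 < ρ ≤ 1/2`, all `u`). [folklore] -/
theorem rampAutocorr_eq_slotSpec_integral {ρ : ℝ} (hρ : 0 < ρ) (hρ2 : ρ ≤ 1 / 2) (u : ℝ) :
    rampAutocorr ρ u = 1 / π * ∫ η in Ioi (0:ℝ), slotSpec ρ η * Real.cos (η * u) := by
  rw [rampAutocorr_eq_integral_trapSpec hρ hρ2]
  have hev : (fun ξ : ℝ => Real.cos (2 * π * (ξ * u)) * trapSpec ρ ξ) =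
      fun ξ : ℝ => Real.cos (2 * π * (|ξ| * u)) * trapSpec ρ |ξ| := by
    funext ξ
    rcases le_or_gt 0 ξ with h | h
    · rw [abs_of_nonneg h]
    · rw [abs_of_neg h]
      unfold trapSpec
      rw [show 2 * π * (-ξ * u) = -(2 * π * (ξ * u)) by ring, Real.cos_neg,
        show π * ρ * -ξ = -(π * ρ * ξ) by ring, show π * (1 - ρ) * -ξ = -(π * (1 - ρ) * ξ) by ring,
        Real.sin_neg, Real.sin_neg, neg_sq, neg_sq, show (-ξ) ^ 4 = ξ ^ 4 by ring]
  rw [hev, integral_comp_abs (f := fun ξ : ℝ => Real.cos (2 * π * (ξ * u)) * trapSpec ρ ξ)]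
  have hg : (fun ξ : ℝ => Real.cos (2 * π * (ξ * u)) * trapSpec ρ ξ) =
      fun ξ : ℝ => (fun η : ℝ => slotSpec ρ η * Real.cos (η * u)) (2 * π * ξ) := by
    funext ξ
    simp only
    rw [slotSpec_two_pi_mul, mul_comm, show 2 * π * ξ * u = 2 * π * (ξ * u) by ring]
  rw [hg, integral_comp_mul_left_Ioi (fun η : ℝ => slotSpec ρ η * Real.cos (η * u)) 0 (by positivity : (0:ℝ) < 2 * π),
    mul_zero, smul_eq_mul]
  have hπ : (π : ℝ) ≠ 0 := Real.pi_ne_zero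
  have key : ∀ I : ℝ, 2 * ((2 * π)⁻¹ * I) = 1 / π * I := fun I => by field_simp
  exact key _

end Inversion

/-! ## §14 THE COSINE MIXTURE (PROVED): `xᵀ f_T(B) z = (T/π)∫₀^∞ Â_ρ(η)·xᵀ (TB)((TB)² + η²)⁻¹ z dη` -/

section Mixture

open scoped Real

theorem slotSpec_eq_trapSpec (ρ η : ℝ) : slotSpec ρ η = trapSpec ρ (η / (2 * π)) := by
  have h := slotSpec_two_pi_mul ρ (η / (2 * π))
  have hπ : (π : ℝ) ≠ 0 := Real.pi_ne_zero
  rw [show 2 * π * (η / (2 * π)) = η by field_simp] at h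
  exact h

/-- The majorant `slotSpec ≤ 8π²(1 + η²)⁻¹` (`0 < ρ ≤ 1`). [folklore] -/
theorem slotSpec_le {ρ : ℝ} (hρ : 0 < ρ) (hρ1 : ρ ≤ 1) (η : ℝ) : slotSpec ρ η ≤ 8 * π ^ 2 * (1 + η ^ 2)⁻¹ := by
  rw [slotSpec_eq_trapSpec]
  refine le_trans (trapSpec_le hρ hρ1 _) ?_
  rw [← div_eq_mul_inv, ← div_eq_mul_inv, div_le_div_iff₀ (by positivity) (by positivity)]
  have hπ : 1 ≤ π := by linarith [Real.pi_gt_three]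
  have hπ0 : (π : ℝ) ≠ 0 := Real.pi_ne_zero
  have e : 8 * π ^ 2 * (1 + (η / (2 * π)) ^ 2) = 8 * π ^ 2 + 2 * η ^ 2 := by
    field_simp
    ring
  rw [e]
  nlinarith [sq_nonneg η]

theorem measurable_slotSpec (ρ : ℝ) : Measurable (fun η : ℝ => slotSpec ρ η) := by
  unfold slotSpec
  fun_prop

/-- The slot spectral weight is integrable. [folklore] -/
theorem integrable_slotSpec {ρ : ℝ} (hρ : 0 < ρ) (hρ1 : ρ ≤ 1) : Integrable (fun η : ℝ => slotSpec ρ η) := by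
  refine Integrable.mono' (integrable_inv_one_add_sq.const_mul (8 * π ^ 2)) (measurable_slotSpec ρ).aestronglyMeasurable
    (Filter.Eventually.of_forall fun η => ?_)
  rw [Real.norm_eq_abs, abs_of_nonneg (slotSpec_nonneg ρ η)]
  exact slotSpec_le hρ hρ1 η

/-- The resolvent atom `R_s(C) = C·(C² + s)⁻¹` (`= ∫₀^∞ cos(√s·u)e^{−uC} du` for coercive `C`, §11). -/
noncomputable def resolventAtom (C : Matrix (Fin 3) (Fin 3) ℝ) (s : ℝ) : Matrix (Fin 3) (Fin 3) ℝ :=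
  C * (C * C + s • (1 : Matrix (Fin 3) (Fin 3) ℝ))⁻¹

/-- **THE COSINE MIXTURE** (the single analytic input of branch B of D24-16, typed in §9 of the sectorial-window memo): for `T > 0` and coercive `B`,
the slot response is the nonnegative mixture of resolvent atoms `f_T(B) = (T/π)∫₀^∞ Â_ρ(η)·(TB)((TB)² + η²)⁻¹ dη` (weak form, with integrability). -/
def CosineMixture (ρ : ℝ) : Prop :=
  ∀ T : ℝ, 0 < T → ∀ (B : Matrix (Fin 3) (Fin 3) ℝ) (lo : ℝ), 0 < lo → (∀ x : Fin 3 → ℝ, lo * (x ⬝ᵥ x) ≤ x ⬝ᵥ B *ᵥ x) →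
    ∀ x z : Fin 3 → ℝ,
      IntegrableOn (fun ξ : ℝ => slotSpec ρ ξ * (x ⬝ᵥ (resolventAtom (T • B) (ξ ^ 2)) *ᵥ z)) (Ioi 0) ∧
      x ⬝ᵥ (qsResp ρ T B) *ᵥ z = T / Real.pi * ∫ ξ in Ioi 0, slotSpec ρ ξ * (x ⬝ᵥ (resolventAtom (T • B) (ξ ^ 2)) *ᵥ z)

/-- **THE COSINE MIXTURE HOLDS** for every profile parameter `0 < ρ ≤ 1/2`.  Proof: `xᵀf_T(B)z = T∫₀^∞ A(u)·xᵀe^{−uTB}z du` (§11),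
`A(u) = (1/π)∫₀^∞ Â_ρ(η)cos(ηu)dη` (§13, Fourier inversion of `𝓕A = |𝓕a|²`), Fubini on `(0,∞)²` (majorant `Â_ρ(η)·e^{−Tλ₀u}|x||z|`), and
the Laplace–cosine transform `∫₀^∞ cos(ηu)·xᵀe^{−uC}z du = xᵀC(C² + η²)⁻¹z` (§11). [folklore] -/
theorem cosineMixture_holds {ρ : ℝ} (hρ : 0 < ρ) (hρ2 : ρ ≤ 1 / 2) : CosineMixture ρ := by
  intro T hT B lo hlo hco x z
  have hTlo : 0 < T * lo := mul_pos hT hlo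
  have hcoT : ∀ y : Fin 3 → ℝ, T * lo * (y ⬝ᵥ y) ≤ y ⬝ᵥ (T • B) *ᵥ y := by
    intro y
    rw [Matrix.smul_mulVec, dotProduct_smul, smul_eq_mul, mul_assoc]
    exact mul_le_mul_of_nonneg_left (hco y) hT.le
  -- the time profile `F(u) = xᵀ e^{−u·TB} z`
  set F : ℝ → ℝ := fun u => x ⬝ᵥ (NormedSpace.exp (-(u • (T • B)))) *ᵥ z with hF
  have hFc : Continuous F := continuous_const.dotProduct (continuous_exp_neg_smul_mulVec (T • B) z)
  set K : ℝ := Real.sqrt (x ⬝ᵥ x) * Real.sqrt (z ⬝ᵥ z) with hK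
  have hFb : ∀ u : ℝ, 0 ≤ u → |F u| ≤ Real.exp (-(T * lo * u)) * K := fun u hu => abs_form_exp_le hcoT x z hu
  -- the joint integrand on `(0,∞)²`
  set G : ℝ × ℝ → ℝ := fun p => slotSpec ρ p.1 * (Real.cos (p.1 * p.2) * F p.2) with hG
  have hGm : AEStronglyMeasurable G ((volume.restrict (Ioi (0:ℝ))).prod (volume.restrict (Ioi (0:ℝ)))) := by
    refine Measurable.aestronglyMeasurable ?_
    exact ((measurable_slotSpec ρ).comp measurable_fst).mul
      ((Real.continuous_cos.measurable.comp (measurable_fst.mul measurable_snd)).mul (hFc.measurable.comp measurable_snd))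
  have hGi : Integrable G ((volume.restrict (Ioi (0:ℝ))).prod (volume.restrict (Ioi (0:ℝ)))) := by
    have hmaj : Integrable (fun p : ℝ × ℝ => slotSpec ρ p.1 * (Real.exp (-(T * lo) * p.2) * K))
        ((volume.restrict (Ioi (0:ℝ))).prod (volume.restrict (Ioi (0:ℝ)))) :=
      ((integrable_slotSpec hρ (by linarith)).integrableOn).mul_prod ((exp_neg_integrableOn_Ioi 0 hTlo).mul_const K)
    refine hmaj.mono' hGm ?_
    rw [Measure.prod_restrict]
    refine (ae_restrict_iff' (measurableSet_Ioi.prod measurableSet_Ioi)).2 (Filter.Eventually.of_forall fun p hp => ?_)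
    have hu : 0 < p.2 := hp.2
    rw [Real.norm_eq_abs, hG]
    simp only
    rw [abs_mul, abs_of_nonneg (slotSpec_nonneg ρ p.1), abs_mul]
    refine mul_le_mul_of_nonneg_left ?_ (slotSpec_nonneg ρ p.1)
    calc |Real.cos (p.1 * p.2)| * |F p.2| ≤ 1 * (Real.exp (-(T * lo * p.2)) * K) :=
          mul_le_mul (Real.abs_cos_le_one _) (hFb p.2 hu.le) (abs_nonneg _) zero_le_one
      _ = Real.exp (-(T * lo) * p.2) * K := by rw [one_mul, neg_mul]
  -- the inner `u`-integral, per frequency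
  have inner : ∀ η : ℝ, ∫ u in Ioi (0:ℝ), G (η, u) = slotSpec ρ η * (x ⬝ᵥ (resolventAtom (T • B) (η ^ 2)) *ᵥ z) := by
    intro η
    simp only [hG]
    rw [integral_const_mul, resolventAtom]
    congr 1
    exact (integral_Ioi_cos_mul_form_exp hTlo hcoT η x z).2
  -- `A(u)·F(u) = (1/π)∫_η G(η,u)`
  have hAu : ∀ u : ℝ, rampAutocorr ρ u * F u = 1 / π * ∫ η in Ioi (0:ℝ), G (η, u) := by
    intro u
    rw [rampAutocorr_eq_slotSpec_integral hρ hρ2 u, mul_assoc, ← integral_mul_const]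
    congr 1
    refine integral_congr_ae (Filter.Eventually.of_forall fun η => ?_)
    simp only [hG]
    ring
  -- Fubini
  have hswap : ∫ u in Ioi (0:ℝ), ∫ η in Ioi (0:ℝ), G (η, u) = ∫ η in Ioi (0:ℝ), ∫ u in Ioi (0:ℝ), G (η, u) :=
    integral_integral_swap (f := fun u η => G (η, u)) hGi.swap
  have hmain : x ⬝ᵥ (qsResp ρ T B) *ᵥ z =
      T / Real.pi * ∫ η in Ioi 0, slotSpec ρ η * (x ⬝ᵥ (resolventAtom (T • B) (η ^ 2)) *ᵥ z) := by
    rw [form_qsResp_eq_autocorr_Ioi hρ T B x z]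
    have e1 : ∫ u in Ioi (0:ℝ), rampAutocorr ρ u * F u = 1 / π * ∫ u in Ioi (0:ℝ), ∫ η in Ioi (0:ℝ), G (η, u) := by
      rw [← integral_const_mul]
      exact integral_congr_ae (Filter.Eventually.of_forall hAu)
    have e2 : ∫ η in Ioi (0:ℝ), ∫ u in Ioi (0:ℝ), G (η, u) =
        ∫ η in Ioi (0:ℝ), slotSpec ρ η * (x ⬝ᵥ (resolventAtom (T • B) (η ^ 2)) *ᵥ z) :=
      integral_congr_ae (Filter.Eventually.of_forall inner)
    rw [e1, hswap, e2]
    ring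
  refine ⟨?_, hmain⟩
  exact (hGi.integral_prod_left).congr (Filter.Eventually.of_forall inner)

end Mixture

/-! ## §15 Sector atoms and EXACT SECTOR NON-EXPANSION of the slot response (branch B of D24-16: `θ = 1`, unconditional) -/

section SectorAtoms

theorem dotProduct_self_nonneg' (x : Fin 3 → ℝ) : 0 ≤ x ⬝ᵥ x := by
  rw [self_dotProduct_eq_sum_sq]; exact Finset.sum_nonneg fun i _ => sq_nonneg _

/-- Discriminant form of a sector inequality: `c·a ≤ m(c²X + Z)/2` for every real `c` (`X, Z ≥ 0`) forces `a² ≤ m²XZ`. -/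
theorem sq_le_of_forall_scale {a m X Z : ℝ} (hX : 0 ≤ X) (hZ : 0 ≤ Z)
    (key : ∀ c : ℝ, c * a ≤ m * ((c ^ 2 * X + Z) / 2)) : a ^ 2 ≤ m ^ 2 * (X * Z) := by
  have hsum : 0 ≤ m * ((X + Z) / 2) := by
    have h1 := key 1
    have h2 := key (-1)
    norm_num at h1 h2
    linarith
  by_cases hxx : X = 0
  · have h1 : ∀ c : ℝ, c * a ≤ m * Z / 2 := by
      intro c; have h := key c; rw [hxx, mul_zero, zero_add] at h; linarith
    have ha0 : a = 0 := by
      by_contra hne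
      have hpos : 0 < a ^ 2 := by positivity
      have h3 := h1 ((m * Z / 2 + 1) / a)
      rw [div_mul_cancel₀ _ hne] at h3
      linarith
    rw [ha0, hxx]; simp
  · have hxpos : 0 < X := lt_of_le_of_ne hX (Ne.symm hxx)
    by_cases hm' : m = 0
    · have h1 : ∀ c : ℝ, c * a ≤ 0 := by intro c; have := key c; rw [hm'] at this; simpa using this
      have ha0 : a = 0 := by
        have h2 := h1 a; have h3 := h1 (-a); nlinarith
      rw [ha0, hm']; simp
    · have hmnn : 0 ≤ m := by
        by_contra hmn
        push_neg at hmn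
        have : m * ((X + Z) / 2) < 0 := mul_neg_of_neg_of_pos hmn (by linarith)
        linarith
      have hmpos : 0 < m := lt_of_le_of_ne hmnn (Ne.symm hm')
      have h := key (a / (m * X))
      have hmx : 0 < m * X := mul_pos hmpos hxpos
      have e : a / (m * X) * a = a ^ 2 / (m * X) := by rw [div_mul_eq_mul_div, sq]
      rw [e] at h
      have e2 : (a / (m * X)) ^ 2 * X = a ^ 2 / (m ^ 2 * X) := by field_simp
      rw [e2] at h
      have h3 : a ^ 2 / (m * X) ≤ m * Z := by
        have : m * ((a ^ 2 / (m ^ 2 * X) + Z) / 2) = a ^ 2 / (m * X) / 2 + m * Z / 2 := by field_simp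
        rw [this] at h
        linarith
      rw [div_le_iff₀ hmx] at h3
      nlinarith

/-- The elementary sum rule behind the atom lemma: `α² ≤ τ²ab`, `β² ≤ τ²cd`, `a, b, c, d ≥ 0` give `(α + β)² ≤ τ²(a + c)(b + d)`. -/
theorem sq_add_le_of_sq_le {α β τ a b c d : ℝ} (ha : 0 ≤ a) (hb : 0 ≤ b) (hc : 0 ≤ c) (hd : 0 ≤ d)
    (h₁ : α ^ 2 ≤ τ ^ 2 * (a * b)) (h₂ : β ^ 2 ≤ τ ^ 2 * (c * d)) :
    (α + β) ^ 2 ≤ τ ^ 2 * ((a + c) * (b + d)) := by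
  -- 2αβ ≤ τ²(ad + bc):  (2αβ)² = 4α²β² ≤ 4τ⁴abcd ≤ τ⁴(ad + bc)²
  have hcross : 2 * (α * β) ≤ τ ^ 2 * (a * d + b * c) := by
    have hsq : (2 * (α * β)) ^ 2 ≤ (τ ^ 2 * (a * d + b * c)) ^ 2 := by
      have hab : α ^ 2 * β ^ 2 ≤ τ ^ 2 * (a * b) * (τ ^ 2 * (c * d)) :=
        mul_le_mul h₁ h₂ (sq_nonneg _) (by positivity)
      have e1 : (2 * (α * β)) ^ 2 = 4 * (α ^ 2 * β ^ 2) := by ring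
      have e2 : (τ ^ 2 * (a * d + b * c)) ^ 2 = (τ ^ 2 * (a * d - b * c)) ^ 2 + 4 * (τ ^ 2 * (a * b) * (τ ^ 2 * (c * d))) := by
        ring
      rw [e1, e2]
      nlinarith [sq_nonneg (τ ^ 2 * (a * d - b * c))]
    exact (abs_le_of_sq_le_sq' hsq (by positivity)).2
  nlinarith

/-- **THE ATOM LEMMA (pre-image form).**  If `C` is sectorial (`(xᵀCz − zᵀCx)² ≤ τ²(xᵀCx)(zᵀCz)`) and accretive, then for `s ≥ 0` the "resolvent atom"
`R = C(C² + s)⁻¹` is sectorial with the SAME `τ`: writing `x = (C² + s)p`, `z = (C² + s)q` (so `Rx = Cp`, `Rz = Cq`), the sector inequality for `R` at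
`(x, z)` is `(xᵀCq − zᵀCp)² ≤ τ²(xᵀCp)(zᵀCq)`, and with `u = Cp`, `v = Cq` one has `xᵀCq = vᵀCu + s·pᵀCq` etc., so it is the sum rule
`sq_add_le_of_sq_le` applied to the sector inequalities at `(u, v)` and at `(p, q)`.  (Complex form: `⟨Rw, w⟩ = conj⟨Bu, u⟩ + s⟨Bv, v⟩ ∈ S_θ`.) [folklore] -/
theorem sector_atom_pre {C : Matrix (Fin 3) (Fin 3) ℝ} {τ s : ℝ} (hs : 0 ≤ s)
    (hsec : ∀ x z : Fin 3 → ℝ, (x ⬝ᵥ C *ᵥ z - z ⬝ᵥ C *ᵥ x) ^ 2 ≤ τ ^ 2 * ((x ⬝ᵥ C *ᵥ x) * (z ⬝ᵥ C *ᵥ z)))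
    (hpos : ∀ x : Fin 3 → ℝ, 0 ≤ x ⬝ᵥ C *ᵥ x) (p q : Fin 3 → ℝ) :
    ((C *ᵥ (C *ᵥ p) + s • p) ⬝ᵥ (C *ᵥ q) - (C *ᵥ (C *ᵥ q) + s • q) ⬝ᵥ (C *ᵥ p)) ^ 2 ≤
      τ ^ 2 * (((C *ᵥ (C *ᵥ p) + s • p) ⬝ᵥ (C *ᵥ p)) * ((C *ᵥ (C *ᵥ q) + s • q) ⬝ᵥ (C *ᵥ q))) ∧
    0 ≤ (C *ᵥ (C *ᵥ p) + s • p) ⬝ᵥ (C *ᵥ p) := by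
  set u := C *ᵥ p with hu
  set v := C *ᵥ q with hv
  have e1 : (C *ᵥ u + s • p) ⬝ᵥ v = v ⬝ᵥ C *ᵥ u + s * (p ⬝ᵥ C *ᵥ q) := by
    rw [add_dotProduct, smul_dotProduct, smul_eq_mul, dotProduct_comm (C *ᵥ u) v, hv]
  have e2 : (C *ᵥ v + s • q) ⬝ᵥ u = u ⬝ᵥ C *ᵥ v + s * (q ⬝ᵥ C *ᵥ p) := by
    rw [add_dotProduct, smul_dotProduct, smul_eq_mul, dotProduct_comm (C *ᵥ v) u, hu]
  have e3 : (C *ᵥ u + s • p) ⬝ᵥ u = u ⬝ᵥ C *ᵥ u + s * (p ⬝ᵥ C *ᵥ p) := by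
    rw [add_dotProduct, smul_dotProduct, smul_eq_mul, dotProduct_comm (C *ᵥ u) u, hu]
  have e4 : (C *ᵥ v + s • q) ⬝ᵥ v = v ⬝ᵥ C *ᵥ v + s * (q ⬝ᵥ C *ᵥ q) := by
    rw [add_dotProduct, smul_dotProduct, smul_eq_mul, dotProduct_comm (C *ᵥ v) v, hv]
  rw [e1, e2, e3, e4]
  refine ⟨?_, add_nonneg (hpos u) (mul_nonneg hs (hpos p))⟩
  have hα : (v ⬝ᵥ C *ᵥ u - u ⬝ᵥ C *ᵥ v) ^ 2 ≤ τ ^ 2 * ((u ⬝ᵥ C *ᵥ u) * (v ⬝ᵥ C *ᵥ v)) := by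
    have h := hsec u v
    have e : (v ⬝ᵥ C *ᵥ u - u ⬝ᵥ C *ᵥ v) ^ 2 = (u ⬝ᵥ C *ᵥ v - v ⬝ᵥ C *ᵥ u) ^ 2 := by ring
    rw [e]; exact h
  have hβ : (s * (p ⬝ᵥ C *ᵥ q) - s * (q ⬝ᵥ C *ᵥ p)) ^ 2 ≤ τ ^ 2 * ((s * (p ⬝ᵥ C *ᵥ p)) * (s * (q ⬝ᵥ C *ᵥ q))) := by
    have h := hsec p q
    have e : (s * (p ⬝ᵥ C *ᵥ q) - s * (q ⬝ᵥ C *ᵥ p)) ^ 2 = s ^ 2 * (p ⬝ᵥ C *ᵥ q - q ⬝ᵥ C *ᵥ p) ^ 2 := by ring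
    rw [e]
    calc s ^ 2 * (p ⬝ᵥ C *ᵥ q - q ⬝ᵥ C *ᵥ p) ^ 2 ≤ s ^ 2 * (τ ^ 2 * ((p ⬝ᵥ C *ᵥ p) * (q ⬝ᵥ C *ᵥ q))) :=
          mul_le_mul_of_nonneg_left h (sq_nonneg s)
      _ = τ ^ 2 * ((s * (p ⬝ᵥ C *ᵥ p)) * (s * (q ⬝ᵥ C *ᵥ q))) := by ring
  have h := sq_add_le_of_sq_le (hpos u) (hpos v) (mul_nonneg hs (hpos p)) (mul_nonneg hs (hpos q)) hα hβ
  have e : v ⬝ᵥ C *ᵥ u + s * (p ⬝ᵥ C *ᵥ q) - (u ⬝ᵥ C *ᵥ v + s * (q ⬝ᵥ C *ᵥ p)) =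
      (v ⬝ᵥ C *ᵥ u - u ⬝ᵥ C *ᵥ v) + (s * (p ⬝ᵥ C *ᵥ q) - s * (q ⬝ᵥ C *ᵥ p)) := by ring
  rw [e]; exact h

/-- **THE ATOM LEMMA.**  For a coercive sectorial `C` (`τ`, `lo > 0`) and `s ≥ 0`, the resolvent atom `R = C(C² + s)⁻¹` is `τ`-sectorial and accretive:
`(xᵀRz − zᵀRx)² ≤ τ²(xᵀRx)(zᵀRz)`, `xᵀRx ≥ 0`. [folklore] -/
theorem sector_resolventAtom {C : Matrix (Fin 3) (Fin 3) ℝ} {τ lo s : ℝ} (hlo : 0 < lo) (hs : 0 ≤ s)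
    (hsec : ∀ x z : Fin 3 → ℝ, (x ⬝ᵥ C *ᵥ z - z ⬝ᵥ C *ᵥ x) ^ 2 ≤ τ ^ 2 * ((x ⬝ᵥ C *ᵥ x) * (z ⬝ᵥ C *ᵥ z)))
    (hco : ∀ x : Fin 3 → ℝ, lo * (x ⬝ᵥ x) ≤ x ⬝ᵥ C *ᵥ x) (x z : Fin 3 → ℝ) :
    (x ⬝ᵥ (resolventAtom C s) *ᵥ z - z ⬝ᵥ (resolventAtom C s) *ᵥ x) ^ 2 ≤
      τ ^ 2 * ((x ⬝ᵥ (resolventAtom C s) *ᵥ x) * (z ⬝ᵥ (resolventAtom C s) *ᵥ z)) ∧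
    0 ≤ x ⬝ᵥ (resolventAtom C s) *ᵥ x := by
  have hpos : ∀ x : Fin 3 → ℝ, 0 ≤ x ⬝ᵥ C *ᵥ x := fun x => le_trans (mul_nonneg hlo.le (dotProduct_self_nonneg' x)) (hco x)
  set M := C * C + s • (1 : Matrix (Fin 3) (Fin 3) ℝ) with hM
  have hdet : IsUnit M.det := isUnit_det_sq_add_of_coercive hlo hs hco
  set p := M⁻¹ *ᵥ x with hp
  set q := M⁻¹ *ᵥ z with hq
  have hx : x = C *ᵥ (C *ᵥ p) + s • p := by
    have : M *ᵥ p = x := by rw [hp, Matrix.mulVec_mulVec, Matrix.mul_nonsing_inv _ hdet, Matrix.one_mulVec]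
    rw [← this, hM, Matrix.add_mulVec, Matrix.smul_mulVec, Matrix.one_mulVec, ← Matrix.mulVec_mulVec]
  have hz : z = C *ᵥ (C *ᵥ q) + s • q := by
    have : M *ᵥ q = z := by rw [hq, Matrix.mulVec_mulVec, Matrix.mul_nonsing_inv _ hdet, Matrix.one_mulVec]
    rw [← this, hM, Matrix.add_mulVec, Matrix.smul_mulVec, Matrix.one_mulVec, ← Matrix.mulVec_mulVec]
  have hRz : (resolventAtom C s) *ᵥ z = C *ᵥ q := by
    unfold resolventAtom; rw [← hM, ← Matrix.mulVec_mulVec]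
  have hRx : (resolventAtom C s) *ᵥ x = C *ᵥ p := by
    unfold resolventAtom; rw [← hM, ← Matrix.mulVec_mulVec]
  rw [hRz, hRx]
  have h := sector_atom_pre (C := C) hs hsec hpos p q
  have h' := sector_atom_pre (C := C) hs hsec hpos q p
  rw [← hx, ← hz] at h
  exact ⟨h.1, h.2⟩

/-- **L1⁺ FROM THE COSINE MIXTURE (PROVED): exact sector NON-EXPANSION of the slot response.**  If `CosineMixture ρ` holds then for `T > 0` and every
coercive `τ`-sectorial block `B` (`lo > 0`), `F = f_T(B)` is `τ`-sectorial: `(xᵀFz − zᵀFx)² ≤ τ²(xᵀFx)(zᵀFz)` — i.e. `θ ≤ 1`, branch B of D24-16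
(`ΛV` up to `1.10`) with NO loss.  (Atoms sector-safe + nonnegative weights + the discriminant trick.) -/
theorem sectorPreservation_of_cosineMixture {ρ : ℝ} (hCM : CosineMixture ρ) {T : ℝ} (hT : 0 < T)
    {B : Matrix (Fin 3) (Fin 3) ℝ} {τ lo : ℝ} (hlo : 0 < lo)
    (hsec : ∀ x z : Fin 3 → ℝ, (x ⬝ᵥ B *ᵥ z - z ⬝ᵥ B *ᵥ x) ^ 2 ≤ τ ^ 2 * ((x ⬝ᵥ B *ᵥ x) * (z ⬝ᵥ B *ᵥ z)))
    (hco : ∀ x : Fin 3 → ℝ, lo * (x ⬝ᵥ x) ≤ x ⬝ᵥ B *ᵥ x) (x z : Fin 3 → ℝ) :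
    (x ⬝ᵥ (qsResp ρ T B) *ᵥ z - z ⬝ᵥ (qsResp ρ T B) *ᵥ x) ^ 2 ≤
      τ ^ 2 * ((x ⬝ᵥ (qsResp ρ T B) *ᵥ x) * (z ⬝ᵥ (qsResp ρ T B) *ᵥ z)) := by
  set F := qsResp ρ T B with hF
  -- the scaled block `T • B` is coercive (`T·lo`) and `τ`-sectorial
  have hcoT : ∀ x : Fin 3 → ℝ, T * lo * (x ⬝ᵥ x) ≤ x ⬝ᵥ (T • B) *ᵥ x := by
    intro y; rw [Matrix.smul_mulVec, dotProduct_smul, smul_eq_mul, mul_assoc]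
    exact mul_le_mul_of_nonneg_left (hco y) hT.le
  have hsecT : ∀ x z : Fin 3 → ℝ, (x ⬝ᵥ (T • B) *ᵥ z - z ⬝ᵥ (T • B) *ᵥ x) ^ 2 ≤
      τ ^ 2 * ((x ⬝ᵥ (T • B) *ᵥ x) * (z ⬝ᵥ (T • B) *ᵥ z)) := by
    intro y w
    simp only [Matrix.smul_mulVec, dotProduct_smul, smul_eq_mul]
    have h := hsec y w
    have e : (T * (y ⬝ᵥ B *ᵥ w) - T * (w ⬝ᵥ B *ᵥ y)) ^ 2 = T ^ 2 * (y ⬝ᵥ B *ᵥ w - w ⬝ᵥ B *ᵥ y) ^ 2 := by ring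
    rw [e]
    calc T ^ 2 * (y ⬝ᵥ B *ᵥ w - w ⬝ᵥ B *ᵥ y) ^ 2 ≤ T ^ 2 * (τ ^ 2 * ((y ⬝ᵥ B *ᵥ y) * (w ⬝ᵥ B *ᵥ w))) :=
          mul_le_mul_of_nonneg_left h (sq_nonneg T)
      _ = τ ^ 2 * (T * (y ⬝ᵥ B *ᵥ y) * (T * (w ⬝ᵥ B *ᵥ w))) := by ring
  have hTlo : 0 < T * lo := mul_pos hT hlo
  -- pointwise atom facts
  have atom : ∀ ξ : ℝ, ∀ y w : Fin 3 → ℝ,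
      (y ⬝ᵥ (resolventAtom (T • B) (ξ ^ 2)) *ᵥ w - w ⬝ᵥ (resolventAtom (T • B) (ξ ^ 2)) *ᵥ y) ^ 2 ≤
        τ ^ 2 * ((y ⬝ᵥ (resolventAtom (T • B) (ξ ^ 2)) *ᵥ y) * (w ⬝ᵥ (resolventAtom (T • B) (ξ ^ 2)) *ᵥ w)) ∧
      0 ≤ y ⬝ᵥ (resolventAtom (T • B) (ξ ^ 2)) *ᵥ y :=
    fun ξ y w => sector_resolventAtom hTlo (sq_nonneg ξ) hsecT hcoT y w
  have hTpi : 0 ≤ T / Real.pi := div_nonneg hT.le Real.pi_pos.le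
  -- abbreviations for the integrands
  set Rξ : ℝ → Matrix (Fin 3) (Fin 3) ℝ := fun ξ => resolventAtom (T • B) (ξ ^ 2) with hRξ
  -- quadratic forms of F are nonnegative
  have hQnn : ∀ y : Fin 3 → ℝ, 0 ≤ y ⬝ᵥ F *ᵥ y := by
    intro y
    rw [hF, (hCM T hT B lo hlo hco y y).2]
    refine mul_nonneg hTpi (setIntegral_nonneg measurableSet_Ioi fun ξ _ => ?_)
    exact mul_nonneg (slotSpec_nonneg ρ ξ) (atom ξ y y).2
  -- the key family of inequalities: c·σ_F(x,z) ≤ τ'(c²Q_F(x) + Q_F(z))/2 with τ' = |τ|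
  have key : ∀ c : ℝ, c * (x ⬝ᵥ F *ᵥ z - z ⬝ᵥ F *ᵥ x) ≤ |τ| * ((c ^ 2 * (x ⬝ᵥ F *ᵥ x) + z ⬝ᵥ F *ᵥ z) / 2) := by
    intro c
    have I1 := hCM T hT B lo hlo hco (c • x) z
    have I2 := hCM T hT B lo hlo hco z (c • x)
    have I3 := hCM T hT B lo hlo hco (c • x) (c • x)
    have I4 := hCM T hT B lo hlo hco z z
    rw [← hF] at I1 I2 I3 I4
    have e1 : (c • x) ⬝ᵥ F *ᵥ z = c * (x ⬝ᵥ F *ᵥ z) := by rw [smul_dotProduct, smul_eq_mul]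
    have e2 : z ⬝ᵥ F *ᵥ (c • x) = c * (z ⬝ᵥ F *ᵥ x) := by rw [Matrix.mulVec_smul, dotProduct_smul, smul_eq_mul]
    have e3 : (c • x) ⬝ᵥ F *ᵥ (c • x) = c ^ 2 * (x ⬝ᵥ F *ᵥ x) := by
      rw [Matrix.mulVec_smul, smul_dotProduct, dotProduct_smul, smul_eq_mul, smul_eq_mul]; ring
    have lhs : c * (x ⬝ᵥ F *ᵥ z - z ⬝ᵥ F *ᵥ x) = T / Real.pi *
        ∫ ξ in Ioi 0, (slotSpec ρ ξ * ((c • x) ⬝ᵥ (Rξ ξ) *ᵥ z) - slotSpec ρ ξ * (z ⬝ᵥ (Rξ ξ) *ᵥ (c • x))) :=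
      calc c * (x ⬝ᵥ F *ᵥ z - z ⬝ᵥ F *ᵥ x) = (c • x) ⬝ᵥ F *ᵥ z - z ⬝ᵥ F *ᵥ (c • x) := by rw [e1, e2]; ring
        _ = T / Real.pi * (∫ ξ in Ioi 0, slotSpec ρ ξ * ((c • x) ⬝ᵥ (Rξ ξ) *ᵥ z)) -
              T / Real.pi * (∫ ξ in Ioi 0, slotSpec ρ ξ * (z ⬝ᵥ (Rξ ξ) *ᵥ (c • x))) := by rw [I1.2, I2.2]
        _ = _ := by rw [integral_sub I1.1 I2.1, mul_sub]
    have rhs : |τ| * ((c ^ 2 * (x ⬝ᵥ F *ᵥ x) + z ⬝ᵥ F *ᵥ z) / 2) = T / Real.pi *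
        ∫ ξ in Ioi 0, |τ| / 2 * (slotSpec ρ ξ * ((c • x) ⬝ᵥ (Rξ ξ) *ᵥ (c • x)) + slotSpec ρ ξ * (z ⬝ᵥ (Rξ ξ) *ᵥ z)) :=
      calc |τ| * ((c ^ 2 * (x ⬝ᵥ F *ᵥ x) + z ⬝ᵥ F *ᵥ z) / 2) = |τ| / 2 * ((c • x) ⬝ᵥ F *ᵥ (c • x) + z ⬝ᵥ F *ᵥ z) := by
            rw [e3]; ring
        _ = |τ| / 2 * (T / Real.pi * (∫ ξ in Ioi 0, slotSpec ρ ξ * ((c • x) ⬝ᵥ (Rξ ξ) *ᵥ (c • x))) +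
              T / Real.pi * (∫ ξ in Ioi 0, slotSpec ρ ξ * (z ⬝ᵥ (Rξ ξ) *ᵥ z))) := by rw [← I3.2, ← I4.2]
        _ = _ := by rw [integral_const_mul, integral_add I3.1 I4.1]; ring
    rw [lhs, rhs]
    refine mul_le_mul_of_nonneg_left ?_ hTpi
    refine setIntegral_mono_on (I1.1.sub I2.1) ((I3.1.add I4.1).const_mul _) measurableSet_Ioi fun ξ _ => ?_
    -- pointwise: Â·σ_R(cx, z) ≤ (|τ|/2)·Â·(Q_R(cx) + Q_R(z))
    have hA := slotSpec_nonneg ρ ξ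
    obtain ⟨hsq, hq1⟩ := atom ξ (c • x) z
    have hq2 := (atom ξ z z).2
    -- |σ| ≤ |τ| √(Q₁Q₂) ≤ |τ|(Q₁+Q₂)/2, via squares
    have hσ : (c • x) ⬝ᵥ (Rξ ξ) *ᵥ z - z ⬝ᵥ (Rξ ξ) *ᵥ (c • x) ≤
        |τ| / 2 * ((c • x) ⬝ᵥ (Rξ ξ) *ᵥ (c • x) + z ⬝ᵥ (Rξ ξ) *ᵥ z) := by
      have hsq' : ((c • x) ⬝ᵥ (Rξ ξ) *ᵥ z - z ⬝ᵥ (Rξ ξ) *ᵥ (c • x)) ^ 2 ≤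
          (|τ| / 2 * ((c • x) ⬝ᵥ (Rξ ξ) *ᵥ (c • x) + z ⬝ᵥ (Rξ ξ) *ᵥ z)) ^ 2 := by
        refine hsq.trans ?_
        have hτ2 : τ ^ 2 = |τ| ^ 2 := (sq_abs τ).symm
        rw [hτ2]
        nlinarith [sq_nonneg ((c • x) ⬝ᵥ (Rξ ξ) *ᵥ (c • x) - z ⬝ᵥ (Rξ ξ) *ᵥ z), sq_nonneg |τ|, abs_nonneg τ,
          mul_nonneg (sq_nonneg |τ|) (sq_nonneg ((c • x) ⬝ᵥ (Rξ ξ) *ᵥ (c • x) - z ⬝ᵥ (Rξ ξ) *ᵥ z))]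
      exact (abs_le_of_sq_le_sq' hsq' (by positivity)).2
    have := mul_le_mul_of_nonneg_left hσ hA
    nlinarith [this]
  have h := sq_le_of_forall_scale (hQnn x) (hQnn z) key
  rwa [sq_abs] at h


/-- **L1⁺ (UNCONDITIONAL): the quasi-static slot response does not expand the numerical-range sector.**  For `0 < ρ ≤ 1/2`, `T > 0` and every coercive
`τ`-sectorial block `B`, `F = f_T(B) = qsResp ρ T B` satisfies `(xᵀFz − zᵀFx)² ≤ τ²(xᵀFx)(zᵀFz)`.  (= `sectorPreservation_of_cosineMixture` ∘ `cosineMixture_holds`.)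
This is the `θ ≤ 1` input that opens branch B of tenure decision D24-16 (`ΛV` up to `1.10`). [folklore] -/
theorem sectorPreservation_qsResp {ρ : ℝ} (hρ : 0 < ρ) (hρ2 : ρ ≤ 1 / 2) {T : ℝ} (hT : 0 < T)
    {B : Matrix (Fin 3) (Fin 3) ℝ} {τ lo : ℝ} (hlo : 0 < lo)
    (hsec : ∀ x z : Fin 3 → ℝ, (x ⬝ᵥ B *ᵥ z - z ⬝ᵥ B *ᵥ x) ^ 2 ≤ τ ^ 2 * ((x ⬝ᵥ B *ᵥ x) * (z ⬝ᵥ B *ᵥ z)))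
    (hco : ∀ x : Fin 3 → ℝ, lo * (x ⬝ᵥ x) ≤ x ⬝ᵥ B *ᵥ x) (x z : Fin 3 → ℝ) :
    (x ⬝ᵥ (qsResp ρ T B) *ᵥ z - z ⬝ᵥ (qsResp ρ T B) *ᵥ x) ^ 2 ≤
      τ ^ 2 * ((x ⬝ᵥ (qsResp ρ T B) *ᵥ x) * (z ⬝ᵥ (qsResp ρ T B) *ᵥ z)) :=
  sectorPreservation_of_cosineMixture (cosineMixture_holds hρ hρ2) hT hlo hsec hco x z

/-- Accretivity of the slot response on coercive blocks: `xᵀ f_T(B) x ≥ 0`. [folklore] -/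
theorem form_qsResp_nonneg {ρ : ℝ} (hρ : 0 < ρ) (hρ2 : ρ ≤ 1 / 2) {T : ℝ} (hT : 0 < T)
    {B : Matrix (Fin 3) (Fin 3) ℝ} {lo : ℝ} (hlo : 0 < lo)
    (hco : ∀ x : Fin 3 → ℝ, lo * (x ⬝ᵥ x) ≤ x ⬝ᵥ B *ᵥ x) (x : Fin 3 → ℝ) :
    0 ≤ x ⬝ᵥ (qsResp ρ T B) *ᵥ x := by
  obtain ⟨-, h⟩ := cosineMixture_holds hρ hρ2 T hT B lo hlo hco x x
  rw [h]
  have hTlo : 0 < T * lo := mul_pos hT hlo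
  have hcoT : ∀ y : Fin 3 → ℝ, T * lo * (y ⬝ᵥ y) ≤ y ⬝ᵥ (T • B) *ᵥ y := by
    intro y
    rw [Matrix.smul_mulVec, dotProduct_smul, smul_eq_mul, mul_assoc]
    exact mul_le_mul_of_nonneg_left (hco y) hT.le
  refine mul_nonneg (div_nonneg hT.le Real.pi_pos.le) (setIntegral_nonneg measurableSet_Ioi fun ξ _ => ?_)
  have hpos : ∀ y : Fin 3 → ℝ, 0 ≤ y ⬝ᵥ (T • B) *ᵥ y :=
    fun y => le_trans (mul_nonneg hTlo.le (dotProduct_self_nonneg' y)) (hcoT y)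
  -- accretivity of the atom from coercivity alone: `x = (C² + s)p`, `Rx = Cp`, `xᵀRx = (Cp)ᵀC(Cp) + s·pᵀCp ≥ 0`
  set C := T • B with hC
  set M := C * C + ξ ^ 2 • (1 : Matrix (Fin 3) (Fin 3) ℝ) with hM
  have hdet : IsUnit M.det := isUnit_det_sq_add_of_coercive hTlo (sq_nonneg ξ) hcoT
  set p := M⁻¹ *ᵥ x with hp
  have hx : x = C *ᵥ (C *ᵥ p) + ξ ^ 2 • p := by
    have : M *ᵥ p = x := by rw [hp, Matrix.mulVec_mulVec, Matrix.mul_nonsing_inv _ hdet, Matrix.one_mulVec]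
    rw [← this, hM, Matrix.add_mulVec, Matrix.smul_mulVec, Matrix.one_mulVec, ← Matrix.mulVec_mulVec]
  have hRx : (resolventAtom C (ξ ^ 2)) *ᵥ x = C *ᵥ p := by
    unfold resolventAtom; rw [← hM, ← Matrix.mulVec_mulVec]
  refine mul_nonneg (slotSpec_nonneg ρ ξ) ?_
  rw [hRx]
  conv_rhs => rw [hx]
  rw [add_dotProduct, smul_dotProduct, smul_eq_mul, dotProduct_comm (C *ᵥ (C *ᵥ p)) (C *ᵥ p)]
  exact add_nonneg (hpos (C *ᵥ p)) (mul_nonneg (sq_nonneg ξ) (hpos p))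

end SectorAtoms



end Summit.AnomalousDissipation.AnomalousDissipation.Theorems.SolenoidalFractalHomogenisation.LagrangianStep.OddGain
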